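import Summits.SmoothPoincare4.SmoothPoincare4.Theses.CylinderEntropy
import Summits.SmoothPoincare4.SmoothPoincare4.Theorems.CylinderEntropyCylinderRungTwoGraphicalIsSphere
import Summits.SmoothPoincare4.SmoothPoincare4.Theorems.CylinderEntropyCylinderRungTwoFluxIdentity
import Summits.SmoothPoincare4.SmoothPoincare4.Theorems.CylinderEntropyCylinderRungTwoOneSheet
import Summits.SmoothPoincare4.SmoothPoincare4.Theorems.CylinderEntropyCylinderRungTwoKillingFluxDefs
import Summits.SmoothPoincare4.SmoothPoincare4.Theorems.CylinderEntropyCylinderRungTwoAreaDissipation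
import Summits.SmoothPoincare4.SmoothPoincare4.Theorems.CylinderEntropyCylinderRungTwoSlabConfinement
import Summits.SmoothPoincare4.SmoothPoincare4.Theorems.CylinderEntropyCylinderRungTwoHamiltonMonotonicity
import Summits.SmoothPoincare4.SmoothPoincare4.Theorems.CylinderEntropyCylinderRungTwoRelaxationOfAreaToFloor
import Summits.SmoothPoincare4.SmoothPoincare4.Theorems.CylinderEntropyCylinderRungTwoAreaToFloorOfRelaxation
import Summits.SmoothPoincare4.SmoothPoincare4.Theorems.CylinderEntropyCylinderRungTwoTiltGap
import Summits.SmoothPoincare4.SmoothPoincare4.Theorems.CylinderEntropyCylinderRungTwoDissipationBudget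
import Summits.SmoothPoincare4.SmoothPoincare4.Theorems.CylinderEntropyCylinderRungTwoAreaToFloorOfQuantization
import Summits.SmoothPoincare4.SmoothPoincare4.Theorems.CylinderEntropyCylinderRungTwoTiltExcess
import Summits.SmoothPoincare4.SmoothPoincare4.Theorems.CylinderEntropyCylinderRungTwoTiltExcessVanishing
import Summits.SmoothPoincare4.SmoothPoincare4.Theorems.CylinderEntropyCylinderRungTwoVerticalTestIdentity
import Summits.SmoothPoincare4.SmoothPoincare4.Theorems.CylinderEntropyCylinderRungTwoFirstMomentIdentity
import Summits.SmoothPoincare4.SmoothPoincare4.Theorems.CylinderEntropyCylinderRungTwoProductTestIdentity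
import Summits.SmoothPoincare4.SmoothPoincare4.Theorems.CylinderEntropyCylinderRungTwoWhiteSheetOfFact
import Summits.SmoothPoincare4.SmoothPoincare4.Theorems.CylinderEntropyCylinderRungTwoEpsilonRegularityOfWhite
import Summits.SmoothPoincare4.SmoothPoincare4.Theorems.CylinderEntropyCylinderRungTwoAreaQuantizationOfAllard
import Summits.SmoothPoincare4.SmoothPoincare4.Theorems.CylinderEntropyRungTwoOfSliceIsolationReduction
import Summits.SmoothPoincare4.SmoothPoincare4.Theorems.CylinderEntropyCylinderRungTwoReduction
import Summits.SmoothPoincare4.SmoothPoincare4.Theorems.CylinderEntropyCylinderRungTwoFiniteTimeHalfOfCrux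
import Summits.SmoothPoincare4.SmoothPoincare4.Theorems.CylinderEntropyCylinderRungTwoStaticMonotonicity
import Summits.SmoothPoincare4.SmoothPoincare4.Theorems.CylinderEntropyCylinderRungTwoSurgeryDefs
import Summits.SmoothPoincare4.SmoothPoincare4.Theorems.CylinderEntropyCylinderRungTwoImmortalLeafRecognition
import Summits.SmoothPoincare4.SmoothPoincare4.Theorems.CylinderEntropyCylinderRungTwoSurgeryTopology
import Summits.SmoothPoincare4.SmoothPoincare4.Theorems.CylinderEntropySliceIsolationOfCor15b
import Summits.SmoothPoincare4.SmoothPoincare4.Theorems.CylinderEntropyImmortalAreaToFloorReduction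
import Literature.Geometry.Riemannian.LowEntropyHypersurfacesFourNeckSurgery
import Literature.Topology.FourManifolds.HomotopyS4SimplyConnected
import Literature.Topology.FourManifolds.SphereSimplyConnected
import Literature.Geometry.Riemannian.SphericalCylinderInclusionDomination
import Literature.Geometry.Riemannian.WhiteLocalRegularityCylinderFlow
import Literature.Geometry.GeometricMeasureTheory.AllardIntegralDensityOfLimits
import Literature.Geometry.Riemannian.SphericalCylinderEntropy
import Literature.Geometry.Riemannian.RoundSphere
import Literature.Geometry.Riemannian.LevelSetMeanCurvature
import Literature.Geometry.Lorentzian.LeviCivitaProofs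
import Literature.Topology.FourManifolds.HomotopyS4CompactProofs
import HarnessLib
import HarnessLib.Audit
import Summits.SmoothPoincare4.SmoothPoincare4.Theorems.CylinderEntropyImmortalAreaToFloorOfSmallTilt
import Summits.SmoothPoincare4.SmoothPoincare4.Theorems.CylinderEntropyCylinderRungTwoParabolicAreaFloor
import Summits.SmoothPoincare4.SmoothPoincare4.Theorems.CylinderEntropyCylinderRungTwoNullSurvivorsDieOfStatic
import Summits.SmoothPoincare4.SmoothPoincare4.Theorems.CylinderEntropyCylinderRungTwoNullSurvivorsDieOfPocket
import Summits.SmoothPoincare4.SmoothPoincare4.Theorems.CylinderEntropyCylinderRungTwoFluxZeroOfPocket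
import Summits.SmoothPoincare4.SmoothPoincare4.Theorems.CylinderEntropyCylinderRungTwoFarPointsJoined
import Summits.SmoothPoincare4.SmoothPoincare4.Theorems.CylinderEntropyCylinderRungTwoSidesDifferOfPocket
import Summits.SmoothPoincare4.SmoothPoincare4.Theorems.CylinderEntropyCylinderRungTwoNullSurvivorsDiePocketOfStatic
import Summits.SmoothPoincare4.SmoothPoincare4.Theorems.CylinderEntropyImmortalAreaToFloor
import Summits.SmoothPoincare4.SmoothPoincare4.Theorems.CylinderEntropyCylinderRungTwoNullSurvivorsDie

/-!
# Line `killing-flux` — crux `CylinderEntropy.CylinderRungTwo` (stmt-SmoothPoincare4-7631, rank 2)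

Skeleton (crux-plan, round 1; planner-cruxplan-stmt-SmoothPoincare4-7631-killing-flux-0, 2026-08-16).
LEAD RESHAPE r1 (prover-line-stmt-SmoothPoincare4-7631-0, 2026-08-16): the registered signatures of
`stub_fluxIdentity` and `stub_graphicalIsSphere` are SPELLED OUT in tree vocabulary (the typed
`JoinedIn` clause, `truncL`, Mathlib/Literature names only), so that a landed `Theorems/` file — which
cannot import this workfile — proves them verbatim; `FluxIdentity` / `GraphicalIsSphere` keep the same
text as readable `def`s and the composition is unchanged (definitional unfolding).
LEAD RESHAPE r2 (2026-08-16, after wave 1): `stub_fluxIdentity` LANDED (p92115, 8-file chain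
`Theorems/CylinderEntropyCylinderRungTwoFluxIdentity*.lean`) and `stub_graphicalIsSphere` LANDED (p74738,
`Theorems/CylinderEntropyCylinderRungTwoGraphicalIsSphere.lean`) — both imported here and no longer
sorried; `stub_relaxation` is RESHAPED into `stub_hamiltonMonotonicity` (Hamilton 1993 monotonicity of
the typed density in `N`) + `stub_largeScaleRelaxation` (the GMT content at scales `τ ≥ 1`), glued by
the worker's sorry-free `relaxation_of`; `stub_epsilonGraphical` is RESHAPED into `stub_verticalGap`
(White ε-regularity + tilt gap: `ν₅ ≠ 0` after one unit of thin flow) + `stub_oneSheet` (immersive shadow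
of a compact connected cross-section is injective), glued by the worker's sorry-free
`epsilonGraphical_of`; all audits of wave 1 found the typed statements TRUE and non-vacuous
(`IsCylinderMCF` faithful, `Measure.comap ι μH[4]` the genuine pull-back, thresholds consistent).
Registered stubs now: 1 `stub_finiteTimeHalf` (lead; crux-equivalent), 3a, 3b, 4a, 4b open; 2, 5 closed.
The vocabulary block is proposed verbatim as `Theorems/CylinderEntropyCylinderRungTwoKillingFluxDefs.lean`
(p93403, review) so that the open stubs are landable from `Theorems/`.
LEAD RESHAPE r3 (2026-08-16, after wave 2): `stub_oneSheet` LANDED (p93836,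
`Theorems/CylinderEntropyCylinderRungTwoOneSheet.lean`) and imported; the vocabulary file LANDED (p93403) and
is IMPORTED — the local copies are gone; `stub_largeScaleRelaxation` is re-registered as the implication
`AreaDissipation → SlabConfinement → LargeScaleRelaxation` with the two classical PDE inputs as their own
registered stubs `stub_areaDissipation` (3b-i) and `stub_slabConfinement` (3b-ii); wave-2 worker of
`stub_hamiltonMonotonicity` LANDED kernel groundwork (`Literature/…/SphericalCylinderEntropySmallScales.lean`
p94200: summability / continuity of the typed series for all `τ > 0`; `…Embedded.lean` p94701: finiteness of
the typed density on embedded cross-sections) and typed the reduction `HamiltonIdentity → MatrixHarnack →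
stub` in work/stubs/StubHamiltonMonotonicity.lean.  Registered stubs now (sorried): 1 `stub_finiteTimeHalf`
(crux-equivalent), 3a, 3b-i, 3b-ii, 3b, 4a; closed: 2, 4b, 5.
LEAD RESHAPE r4 (2026-08-16, after wave 3): `stub_areaDissipation` LANDED (p95906 + p96044) and
`stub_slabConfinement` LANDED (p95829), both imported (same namespace, sorried copies removed); the
wave-3 session on `stub_hamiltonMonotonicity` LANDED the kernel theory in Literature — Gegenbauer ODE
(p95653), zonal heat equation (p95828), all-jet majorants / joint smoothness (p96134, p96678), ambient
kernel calculus and backward heat equation `∂_τ k = Δ_N k + k/(2τ)` (p96948), and Hamilton's MATRIX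
HARNACK inequality for the typed kernel along `N` (p97472, `harnackQuadratic_nonneg`) — so the reduction
in work/stubs/StubHamiltonMonotonicity.lean is now `hamiltonMonotonicity_of_identity : HamiltonIdentity →
stub`, with `HamiltonIdentity` = transport formula along `IsCylinderMCF` + `∫_Σ Δ_Σ(k|Σ) = 0`.
Sorried now: 1 `stub_finiteTimeHalf`, 3a `stub_hamiltonMonotonicity`, 3b `stub_largeScaleRelaxation`
(GMT core, implication form), 4a `stub_verticalGap`.
LEAD RESHAPE r5 (after wave 4): `stub_hamiltonMonotonicity` LANDED (transport formula, frame calculus, Green identity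
on the slice, kernel along the flow, density as a Bochner integral, Hamilton's monotonicity FORMULA, assembly with the
matrix Harnack inequality) and imported.  Sorried now: 1 `stub_finiteTimeHalf` (crux-equivalent), 3b
`stub_largeScaleRelaxation` (GMT core), 4a `stub_verticalGap` (White ε-regularity + tilt gap).
LEAD RESHAPE r6 (lead C = prover-line-stmt-SmoothPoincare4-7631-c1-0, continuation seat, 2026-08-16T16:xxZ;
lead A ended with `promote-stub stub_finiteTimeHalf`).  (i) 3b `stub_largeScaleRelaxation` (implication form) is
REPLACED by the crisper GMT core `stub_areaToFloor` — along the immortal flow the area returns to the floor,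
`μH⁴(M_t) ≤ (1+ε) μH⁴(S⁴)` at some `t ≥ T` — plus the glue `stub_relaxationOfAreaToFloor :
HamiltonMonotonicity → AreaToFloor → Relaxation`, PROVED below from a soft large-scale lemma: Hamilton's
monotonicity with lag `σ = s - t₁` moves every density of `M_s` to a density of `M_{t₁}` at scale `≥ σ`, where
the typed kernel is `≤ 1 + t(σ)` pointwise (`t(τ) = e^{-τ}/(1-e^{-τ})`, the geometric tail of the tree's
`abs_term_le`), so `λ_cyl(M_s) ≤ (1 + t(s-t₁)) · μH⁴(M_{t₁})/μH⁴(S⁴)`; no Allard regularity, no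
equicontinuity, no `τ ≥ 1` bookkeeping and no use of `SliceCalibration` remain in the immortal half outside
`stub_areaToFloor`.  (ii) 4a `stub_verticalGap` is SPLIT into `stub_epsilonRegularity` (White's local
regularity for one unit of `(1+ε)`-thin flow, typed by its two consumable outputs: an extrinsic Lipschitz
bound for the vertical component `ν₅` of the unit normal at a universal scale `r₀`, and a lower area bound
`c r⁴ ≤ μH⁴(M_t ∩ B(F t x, r))` for `r ≤ r₀`; the XL core) and `stub_tiltGap : EpsilonRegularity → VerticalGap`
(ELEMENTARY: the landed flux identity gives `∫|ν₅| ≥ vol S⁴`, the entropy bound gives `area ≤ (1+ε) vol S⁴`,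
so `∫ (1-|ν₅|) ≤ ε vol S⁴`, while a zero of `ν₅` costs `≥ (1 - C r) c r⁴`).  Sorried now: 1 `stub_finiteTimeHalf`
(crux-equivalent, promoted), 3b' `stub_areaToFloor` (GMT core), 4a-i `stub_epsilonRegularity` (White core),
4a-ii `stub_tiltGap` (wave 1).
LEAD RESHAPES r7/r8 (lead C, 2026-08-16T17–18Z; registered by lead c2 = prover-line-stmt-SmoothPoincare4-7631-c2-0,
the continuation seat, because the farm was unreachable when lead C ended).  r7: `stub_tiltGap` LANDED (p115218,
`…TiltGap.lean`), `stub_relaxationOfAreaToFloor` LANDED (p114786, `…RelaxationOfAreaToFloor.lean`; converse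
`helper_areaToFloorOfRelaxation` p116890) — both imported, local copies removed; `stub_areaToFloor` is SPLIT into the
parabolic `stub_dissipationBudget` (LANDED p117610, `…DissipationBudget.lean`:
`∫_T^t ∫ ‖∂_r F‖² dμ_r dr + μH⁴(M_t) ≤ μH⁴(M_T)`), the FLOW-FREE GMT core `stub_areaQuantization` (almost-stationary
slab-confined separating embedded cross-sections have area limits in `ℕ · μH⁴(S⁴)`: Allard's integral compactness
theorem + horizontality of stationary limits + constancy + integrality; sorried below) and the glue
`helper_areaToFloorOfQuantization` (LANDED p117150, `…AreaToFloorOfQuantization.lean`), so that `stub_areaToFloor` is now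
a THEOREM of this file modulo `stub_areaQuantization`; the tilt-excess identity `∫(1 - ν₅²) dμ = ∫ H z₅ ν₅ dμ`
(`helper_tiltExcessIdentity`, LANDED p119344, `…TiltExcess.lean`) is the horizontality step at the level of the smooth
approximants.  r8: SECOND PATH — the landed flow interface of support item stmt-SmoothPoincare4-14765
(`Theorems/CylinderEntropyRungTwoOfSliceIsolationReduction.lean`, `rungTwoOfSliceIsolation_of_flow`) with
`Flow := IsCylinderMCF`, STUB 1 and the relaxation chain gives `rungTwoOfSliceIsolation_of_stubs : RungTwoOfSliceIsolation`
(item 14765 modulo exactly {`stub_finiteTimeHalf`, `stub_areaQuantization`}) and hence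
`CylinderRungTwo_of_sliceIsolation : SliceIsolation → CylinderRungTwo` — the crux from {finiteTimeHalf, areaQuantization}
plus EITHER `stub_epsilonRegularity` (White, path A, `CylinderRungTwo_of`) OR the rank-3 crux `SliceIsolation`
(stmt-SmoothPoincare4-7632) BY NAME (path B; its own line needs no parabolic regularity).  Sorried now: 1
`stub_finiteTimeHalf` (crux-equivalent, promoted), 3b'-ii `stub_areaQuantization` (Allard core), 4a-i
`stub_epsilonRegularity` (White core, path A only).
LEAD RESHAPE r9 (lead c2, 2026-08-16T19–20Z, after wave 1 of c2): (i) `stub_epsilonRegularity` is now a THEOREM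
modulo the new registered stub `stub_whiteRegularitySheet` = White's local regularity theorem (Ann. of Math. 161 (2005)
Thm. 3.1 + §4) for cylinder flows in single-sheet form, stated with EUCLIDEAN Gaussian density ratios `gaussianArea` on
a two-sided parabolic window (a weakening of the printed theorem; see `WhiteRegularitySheet`) — via the LANDED glue
`helper_epsilonRegularityOfWhite` (p123017, `…EpsilonRegularityOfWhite.lean`), whose kernel comparison "small-scale
Gaussian domination for the inclusion `N ⊂ ℝ⁶`" (`gaussianArea 4 y (r²) A ≤ (1+δ) λ_cyl(A)` for `r ≤ r₁(δ)`, from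
the tree's PROVED Cheeger–Yau bound) LANDED in Literature (p122897,
`Literature/Geometry/Riemannian/SphericalCylinderInclusionDomination.lean`); so path A's analytic debt is LITERALLY a
published theorem.  (ii) Bricks of the area-quantization argument at the level of the smooth approximants LANDED as
registered helpers: `helper_verticalTestIdentity` (p121009, `…VerticalTestIdentity.lean`: `∫ Ψ''(z₅)(1-ν₅²) dμ =
∫ H Ψ'(z₅) ν₅ dμ`, the horizontality test family), `helper_firstMomentIdentity` (p121361, `…FirstMomentIdentity.lean`:
`4∫ Φ(z₅) zᵢ dμ =` tilt- and `H`-small terms, the `k = 1` harmonic of the constancy / S⁴-equidistribution step),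
`helper_tiltExcessVanishing` (p121344, `…TiltExcessVanishing.lean`: along the hypotheses of `stub_areaQuantization` the
tilt excess `∫ (1-ν₅²) d(ι_k^*μH⁴) → 0`), `helper_productTestIdentity` (p123459, `…ProductTestIdentity.lean`: the Green
identity for EVERY product test function `Φ(z₅) P(z')`, `P ∈ C²(ℝ⁵)` — with `P` a degree-`k` harmonic this is the
`k`-th spherical-harmonic moment identity `k(k+3) ∫ Φ P dμ =` tilt/`H`-small terms, i.e. the whole S⁴-equidistribution
input).  Sorried now: 1 `stub_finiteTimeHalf` (crux-equivalent, promoted),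
3b'-ii `stub_areaQuantization` (residual = Allard's integral compactness + constancy + integrality), 4a-i'
`stub_whiteRegularitySheet` (White 2005, published; path A only).
LEAD RESHAPE r10 (lead c2, 2026-08-16T21–23Z, waves 2–3 of c2, 13 workers, all landed): `stub_areaQuantization` is now a THEOREM
modulo the new registered stub `stub_allardIntegralDensity` = Allard's integrality of limits (Ann. of Math. 95 (1972) Thm 6.4 +
§3.5, varifold-free: weak limits of the area measures of cross-sections with bounded area and bounded `∫|H|` have positive
INTEGER `4`-density a.e.; see `AllardIntegralDensityOfLimits`), via the LANDED assembly `helper_areaQuantizationOfAllard`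
(`…AreaQuantizationOfAllard.lean`) over eleven landed helpers: Prokhorov limit, product-test limit, the heat semigroup of `S⁴`
from the typed zonal kernel (smoothness, heat equation, large/small time, mass and first moment), S⁴-equidistribution, small
caps, product identification and its density, atomic quantization.  Sorried now — ALL THREE ARE NAMED CLASSICAL STATEMENTS:
1 `stub_finiteTimeHalf` (crux-equivalent = SPC4 for thin cross-sections, promoted), 3b'-iii `stub_allardIntegralDensity`
(Allard 1972), 4a-i' `stub_whiteRegularitySheet` (White 2005; path A only — path B uses `SliceIsolation` by name instead).
LEAD RESHAPE r11 (lead c2, same night): both analytic debts are now Literature NAMED FACTS (accepted definitions, statement only):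
`stub_allard1972 : Literature.Geometry.GeometricMeasureTheory.Allard1972_integralDensityOfLimits_cylinderCrossSections` (p126280; the
r10 statement is its definitional unfolding) and `stub_white2005 : Literature.Geometry.Riemannian.White2005_localRegularity_cylinderFlowSheet`
(p126352; → `stub_whiteRegularitySheet` by the landed glue `helper_whiteSheetOfFact` p126341), and the crux ⇒ `stub_finiteTimeHalf`
direction is an importable tree theorem (`helper_finiteTimeHalfOfCylinderRungTwo`, p126705, `…FiniteTimeHalfOfCrux.lean`: vertical
translation invariance of `λ_cyl` + the calibration at every height).  Sorried now: `stub_finiteTimeHalf` (= SPC4 for thin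
cross-sections), `stub_allard1972`, `stub_white2005` — one open problem and two EXISTING named facts of the Literature.
LEAD RESHAPE r12 (lead c3 = prover-line-stmt-SmoothPoincare4-7631-c3-0, continuation seat, 2026-08-16T21:5xZ): the sorry-free
COMPOSITION itself is now a landed tree theorem — `Theorems/CylinderEntropyCylinderRungTwoReduction.lean` (p127456 ACCEPTED):
`helper_cylinderRungTwoOfNamedFacts : FiniteTimeHalf → Allard1972_… → White2005_… → CylinderRungTwo` (path A) and
`helper_cylinderRungTwoOfAllardAndIsolation : FiniteTimeHalf → Allard1972_… → SliceIsolation → CylinderRungTwo` (path B); so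
`CylinderRungTwo_of` / `CylinderRungTwo_of_sliceIsolation` below are three-argument applications of landed theorems to the three
registered stubs, and with `helper_finiteTimeHalfOfCylinderRungTwo` (p126705) the tree carries `CylinderRungTwo ↔ FiniteTimeHalf`
modulo the two published named facts (`cylinderRungTwo_iff_finiteTimeHalf` below, sorry-free given the two fact stubs).
Sorried now (unchanged): `stub_finiteTimeHalf`, `stub_allard1972`, `stub_white2005`.
LEAD CYCLE-1 HELPERS (lead c3, all ACCEPTED, registered on the item): non-vacuity / normalisation of the two named facts —
`helper_allardDensityStaticSlice` (p127694, `…AllardDensityStaticSlice.lean`: the Allard fact's conclusion holds with N = 1 at every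
point of every slice measure μH⁴⌊(S⁴×{c}), SAME Mathlib `μH[4]` upstairs and in `μH[4](B⁴(0,r))`) and `helper_sliceLowerAreaBound`
(p128190, `…SliceLowerAreaBound.lean`: White's (b') on slices with universal constants); and the UNIT LOWER DENSITY ALONG CYLINDER
FLOWS chain — `helper_gaussianAreaLeCylDensity` (p128725, density-level Cheeger–Yau domination at centres on N),
`helper_continuousAt_cylDensity` (p128871, continuity of the typed density in the scale), `helper_liminfCylDensityAtPoint` (p128984,
liminf_{σ→0⁺} F̂_{ι x₀,σ}(ι M) ≥ 1 via Colding–Minicozzi 7.2(3)), `helper_unitLowerDensityAlongFlow`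
(`…UnitLowerDensity.lean`: `1 ≤ F̂_{F(s+σ)x, σ}(F_s M)` for every `IsCylinderMCF`, Hamilton monotonicity + the two previous) —
the monotonicity half of clearing-out / integrality for flow limits (atoms of the limit height measure weigh ≥ vol S⁴).
LEAD c4 (prover-line-stmt-SmoothPoincare4-7631-c4-0, continuation seat, r14, 2026-08-16T22:3xZ–08-17T02:2xZ): stubs UNCHANGED
(`stub_finiteTimeHalf`, `stub_allard1972`, `stub_white2005`); 23 registered helpers landed BELOW them in two Allard-free programmes
(integration note `Cruxes/CylinderRungTwo/INTEGRATION-C4-r14.md`, memo `…/INTEGRALITY-MEMO-c4.md`).  (A) STATIC GAUSSIAN MONOTONICITY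
in `N ⊂ ℝ⁶` for closed cross-sections (`…GaussianWeightCalculus` p130810, `…StaticMonotonicityIdentity` p131011,
`…GaussianDensityScaleDerivative` p130667, `…LocalAreaBoundOfTwoScale` p130701, `…StaticMonotonicity` p131292):
`e^{4σ}F(σ) ≤ e^{4τ}F(τ) + e^{4τ}(64π²σ)⁻¹∫H²` and the uniform local area bound `μ_g(f⁻¹B(x₀,ρ)) ≤ e^{4R²+1/4}(μ_g(M)ρ⁴/R⁴ + ρ²∫H²/4)`
(uniform upper density ratios at all scales `ρ ≥ (∫H²)^{1/2}` — the hypothesis of every GMT compactness theorem).  (B) RELAXATION UP TO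
MULTIPLICITY for thin immortal cylinder flows (`…GoodTimes` p131807, `…ShiftLemma` p132547, `…CylKernelSlabBounds` p132106,
`…KernelMassOfProduct` p131737, `…KernelIntegralTendstoOfWeakLimit` p131821, `…AtomOfLiminfDensity` p132206,
`…LiminfDensityAlongGoodTimes` p132832, `…ProductLimitOnSlice` p132720, `…LimitHeightUnique` p133225, `…HeightsConvergeOfUnique` p133157,
`…HeightsConverge` p134255, `…MeasureConvergesToSlice` p134148, `…UpperDensityAllScales` p133536): for `IsCylinderMCF` with `λ_cyl < 2`,
every limit height of points carries an atom `≥ vol S⁴` of the product limit (unit lower density moved to good times by the shift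
lemma), the mass is `< 2 vol`, so the HEIGHTS CONVERGE UNIFORMLY TO ONE VALUE `c` (`helper_heightsConverge`), the area measures converge to
`(A_∞/vol)·[S⁴×{c}]` (`helper_measureConvergesToSlice`), and `F̂_{p,τ}(M_s) ≤ (1+ε)A_∞/vol` at ALL scales/centres for large `s`
(`helper_upperDensityAllScales`) — see `## Relaxation up to multiplicity` below.  The residual of `stub_areaToFloor` (hence of
`stub_allard1972`'s role on path B) is exactly UNIT MULTIPLICITY `A_∞ = vol`.
LEAD RESHAPE r15 (lead c5 = prover-line-stmt-SmoothPoincare4-7631-c5-0, continuation seat, 2026-08-17T01–02Z): THE CUT OF THE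
FINITE-TIME HALF IS CHANGED and both analytic debts are taken BY NAME from the route.  (i) `stub_finiteTimeHalf` (kept registered:
promoted, crux-equivalent) is badly cut — it demands an immortal smooth flow OF `M` ITSELF, while its intended proof (CMS generic
perturbation + Daniels-Holgate neck surgery in `N`) yields a surgery TREE whose separating survivors are connected summands of `M`,
so that identifying the root with `M` already needs the immortal analysis of every survivor.  The new lead stub
`stub_cylinderSurgeryFlow` asks exactly for what that proof proves: a mean-curvature-flow-with-neck-surgery STRUCTURE in `N`
resolving some slice of `M` — the inductive `CylNeckSurgeryResolvable M κ` (vocabulary file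
`Theorems/CylinderEntropyCylinderRungTwoSurgeryDefs.lean`, p136582 ACCEPTED; inlined at r15, imported since r16), which copies the tree's
Euclidean `Literature.Geometry.Riemannian.MCFNeckSurgeryResolvable` (discard / flow / of_diffeomorph / cut / cutNonseparating, with
`IsClassicalMCF` ↦ `IsCylinderMCFOn`) and adds ONE leaf, `immortal`: an immortal thin end-separating `IsCylinderMCF` of that compact
connected component.  (ii) The immortal half is `stub_areaToFloor` (re-registered as a sorried stub; it IS the route crux
`ImmortalAreaToFloor`, stmt-SmoothPoincare4-17197, verbatim up to the landed folding `immortalAreaToFloor_of_stubShape` p131170, and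
has its own prover with an Allard-free blueprint) and the recognition of immortal leaves is PROVED here
(`immortalLeafRecognition_of`): `stub_areaToFloor` + the landed `stub_relaxationOfAreaToFloor`/`stub_hamiltonMonotonicity` give a
late slice with `λ_cyl < 1 + ε₀`, `ε₀ = 4/(1.47e) - 1`, and the landed conformal domination of crux 7632's line
(`stub_dominationBookkeeping`, `stub_conformalEmbedding`, certificates `certMid_all`) + the named fact `stub_cor15bFour`
(Chodosh–Mantoulidis–Schulze 2025 Cor. 1.5 (b), `n = 4`, simply connected case; `SliceIsolation` itself is closed modulo it,
p132345) recognise a SIMPLY CONNECTED compact leaf as `S⁴`.  (iii) The topology is PROVED here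
(`CylNeckSurgeryResolvable.nonempty_diffeomorph_sphere`: induction over the surgery tree into the tree's
`IsNeckSurgeryResolvable` — discards are model pieces, cuts are the `surgery` constructor with simply connected capped sides,
non-separating necks do not exist, immortal leaves are spheres by (ii) — then Kervaire–Milnor).  So
`CylinderRungTwo_of := cylinderRungTwo_of_surgery stub_cylinderSurgeryFlow stub_areaToFloor stub_cor15bFour`; the White / Allard
paths survive as HYPOTHESIS-STYLE theorems (`CylinderRungTwo_of_namedFacts`, no sorry), `stub_allard1972` / `stub_white2005` are no
longer stubs, and `stub_finiteTimeHalf` is both a corollary (`finiteTimeHalf_of_surgery`) and still sufficient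
(`CylinderRungTwo_of_finiteTimeHalf`, through `SliceIsolation` from `stub_cor15bFour`).  Sorried now: `stub_cylinderSurgeryFlow`
(research: the CMS/DH port to `N`), `stub_areaToFloor` (= item 17197), `stub_cor15bFour` (published named fact),
`stub_finiteTimeHalf` (promoted; redundant given the first).
LEAD RESHAPE r17 (lead c6 = prover-line-stmt-SmoothPoincare4-7631-c6-0, continuation seat, 2026-08-17T02–03Z; source-checked PORT
LEDGER `Cruxes/CylinderRungTwo/PORT-LEDGER-c6.md`).  Reading CMS II (arXiv:2309.03856 §§1, 2, 4.1, 5, 6) and Daniels-Holgate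
(arXiv:2104.11647 §1) against `N` shows that, besides the two printed programmes (CMS Thm. 1.13 density drop / DH surgery, both
blow-up-local or with `N`-versions landed), the finite-time stub hides ONE `N`-specific statement of the immortal-half kind that the
Euclidean papers never need (there everything becomes extinct): after the last surgery a NULL-HOMOLOGOUS compact connected component
must not flow smoothly forever — the degree-`0` twin of ImmortalAreaToFloor (17197 is degree `±1`).  r17 FACTORS IT OUT:
`stub_nullSurvivorsDie` (no immortal thin smooth cylinder flow of a compact connected cross-section whose slices never separate the
ends) is a registered stub, the research stub is WEAKENED to `stub_cylinderSurgeryFlowOrNull` (the surgery tree OR such a null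
survivor — literally what CMS + DH + the elementary bookkeeping produce in `N`), and `stub_cylinderSurgeryFlow` /
`stub_finiteTimeHalf` become DERIVED theorems of this file (no sorry of their own).  The bookkeeping fact that IS provable now
LANDED: THE PARABOLIC AREA FLOOR `helper_volLeAreaAlongCylinderFlow` (p138658, `…ParabolicAreaFloor.lean`): along every immortal
smooth cylinder flow of a non-empty closed cross-section `μH⁴(S⁴) ≤ μH⁴(F_t M)` — no separation, no entropy — so split-off
components of small area are never immortal.  Also landed (wave 1 of c6, the RIGIDITY LAYER of the ladder): `helper_killingIdentity`
(p138484: `∫ H ν₅ dμ_g = 0`, no compact translators), `helper_heightConstOfHorizontal` (p138546), `helper_horizontalOfTiltExcessZero`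
(p138560), `helper_sliceOfConstantHeight` (p138805: a constant-height compact connected embedded cross-section IS the slice and
`≅ S⁴`); wave 2: `helper_translatorIsMinimal` (p138991: `H = a ν₅ ⇒ H ≡ 0`, no compact translators), `helper_minimalIsSlice` (p139182:
ONLY SLICES ARE CLOSED CONNECTED MINIMAL CROSS-SECTIONS OF `N`), `helper_sliceOfAreaEqFloor` (p139200: equality case of the area floor);
wave 3: `helper_staticLeafIsSphere` (p139749: STATIC immortal leaves are slices and `≅ S⁴` — the recognition interface is exact on the
fixed points of the flow, unconditionally), `helper_nullSurvivorProfile` (p139486: the landed profile of a would-be null survivor —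
`vol ≤ area < 2 vol` at all times, heights converge); lead: `helper_sliceOfCylEntropyLeOne` + `cylEntropy_eq_one_iff_slice` (p139823:
RIGIDITY OF RUNG ONE — a separating connected cross-section has `λ_cyl = 1` iff it is a slice, the equality case that `SliceIsolation`
quantifies) and `helper_translatorIsSlice` (p139860: compact translating solitons of `N` are slices).  r17b (same day): the null-survivor
branch carries BOTH defects (never separating AND zero vertical flux), so `stub_nullSurvivorsDie` is a pure GMT statement.  (The c6 files are kept out of this skeleton's
import closure, like c4's, so that the skeleton elaborates on every farm node while the newest modules build; import them directly.)  Sorried now: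
`stub_cylinderSurgeryFlowOrNull` (research: the CMS/DH port proper), `stub_nullSurvivorsDie` (17197-class GMT, degree 0),
`stub_areaToFloor` (= item 17197), `stub_cor15bFour` (published named fact), `stub_certMid` (landed computational, kept sorried for
standard axioms).
LEAD RESHAPE r18 (lead c7 = prover-line-stmt-SmoothPoincare4-7631-c7-0, continuation seat, 2026-08-17T04Z): THE DEGREE-ZERO GMT STUB IS MADE
STATIC.  `stub_nullSurvivorsDie` (r17, a statement about immortal FLOWS) is now a DERIVED theorem: the new registered stub
`stub_nullThinStatic` is ONE static, flow-free, entropy-using lemma — the degree-`0` twin of 17197's residual `areaNearFloorOfSmallTilt`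
(no compact connected embedded non-separating cross-section with `|z₅| ≤ B`, `λ_cyl ≤ 2 - δ`, area `≥ vol`, tilt excess `≤ ε`, `∫ H² ≤ ε` and
vertical flux `0`, for `ε = ε(δ, B)`) — and the glue `helper_nullSurvivorsDieOfStatic` (LANDED p141073,
`Theorems/CylinderEntropyCylinderRungTwoNullSurvivorsDieOfStatic.lean`, imported) derives the flow statement from it over landed theorems only
(uniform entropy gap, height bound, good times from the dissipation budget with `∫ H² → 0`, `tendsto_lintegral_tiltExcess_comap`, and the
PARABOLIC AREA FLOOR `helper_volLeAreaAlongCylinderFlow`, which is where immortality is consumed), exactly as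
`immortalAreaToFloor_of_areaNearFloorOfSmallTilt` (p132884) does for 17197.  So the two GMT residuals of the line are now two STATIC lemmas of
one family (degree `±1`: `stub_areaToFloor` = 17197 ⇐ `areaNearFloorOfSmallTilt`; degree `0`: `stub_nullThinStatic`), which one blueprint
(17197-c1's covering argument in degree form, or Allard compactness + constancy + a small-scale entropy argument) proves together.  Sorried now:
`stub_cylinderSurgeryFlowOrNull` (research: the CMS/DH port proper), `stub_nullThinStatic` (static degree-0 GMT), `stub_areaToFloor` (= item
17197), `stub_cor15bFour` (published named fact), `stub_certMid` (landed computational, kept sorried for standard axioms).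
LEAD RESHAPE r19 (lead c7, same cycle, after wave 1 — four workers, 4/4 landed): THE NULL-SURVIVOR BRANCH IS PURE PATH TOPOLOGY.  Wave 1 landed the
Jordan–Brouwer-free flux bookkeeping: `helper_farPointsJoined` (p141572), `helper_sidesDifferOfPocket` (p143000: a POCKET — a complement point that
cannot reach the lower end — forces the two push-off sides to differ), `helper_fluxZeroOfPocket` (p143625: non-separating + pocket ⇒ the crossing
count of `stub_fluxIdentity` runs from "lower" to "lower", so `N₊ = N₋` a.e. and the vertical flux is `0`) and the glue `helper_nullSurvivorsDieOfPocket`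
(p143711).  So the second disjunct of the research stub `stub_cylinderSurgeryFlowOrNull` now asks only that the survivor's slices NEVER SEPARATE and
HAVE A POCKET (both immediate for the capped-off null-homologous side of a neck surgery, `∂(pocket)`), the zero flux that the GMT stub needs being
DERIVED; `nullSurvivorsDie_pocket` kills that branch modulo `stub_nullThinStatic`, and `stub_cylinderSurgeryFlow` / `stub_finiteTimeHalf` stay derived.
Sorried now (unchanged set): `stub_cylinderSurgeryFlowOrNull`, `stub_nullThinStatic`, `stub_areaToFloor` (= 17197), `stub_cor15bFour`, `stub_certMid`.
LEAD RESHAPE r20 (lead c7, same cycle, after wave 2 — two workers, 2/2 landed): THE STATIC STUB TAKES THE POCKET, NOT THE FLUX.  Because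
`pocket + non-separating ⇒ crossing parity N₊ = N₋ a.e. ⇒ flux 0` is landed (`helper_crossingParityOfPocket` p144812, `helper_fluxZeroOfPocket`
p143625) while `flux 0 ⇒ pocket` would need Jordan–Brouwer, the hypotheses of `stub_nullThinStatic` are restated in the Lean-STRONGER pocket form
(same conclusion `False`; the stub became weaker, i.e. easier, and its prover inherits the parity/flux lemmas), and `nullSurvivorsDie_pocket` is ONE
application of the new glue `helper_nullSurvivorsDiePocketOfStatic` (p144284, the pocket twin of p141073).  r17's flux-form `stub_nullSurvivorsDie`
is superseded and dropped.  Analysis brick of wave 2: `helper_cylKernel_lipschitzOn` (p146091, `…CylKernelLipschitz.lean`): the typed kernel is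
Lipschitz on the solid cylinder `{∑_{i<5} z_i² ≤ 1}` uniformly in the centre `p ∈ N` and the scale `τ ≥ τ₀` — the analytic content of ingredient #6
of the port ledger (upper semi-continuity of `λ_cyl` under `C⁰`-small deformations at scales `≥ τ₀`).  Sorried now (unchanged set):
`stub_cylinderSurgeryFlowOrNull`, `stub_nullThinStatic`, `stub_areaToFloor` (= 17197), `stub_cor15bFour`, `stub_certMid`.
LEAD RESHAPE r21 (lead c7, same cycle): THE IMMORTAL HALF AND THE NULL SURVIVORS ARE THEOREMS.  (a) Item 17197 `ImmortalAreaToFloor` was PROVED by its seat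
(`areaToFloor`, p144604, Allard-free) — `stub_areaToFloor := areaToFloor`.  (b) NULL SURVIVORS DIE is PROVED outright (`helper_nullSurvivorsDiePocket`,
`…NullSurvivorsDie.lean`): `areaToFloor`'s proof with the area-floor form of the late upper Gaussian density (`helper_upperGaussianDensityLateOfFloor`, p148054,
fed by the parabolic area floor p138658) and a degree-zero endgame (crossing parity `helper_crossingParityOfPocket` p144812 + degree-zero counting
`helper_parityCounting`: the good set is dominated by the bad set, contradicting the floor).  The static stub `stub_nullThinStatic` (r18/r20) is DELETED.
Sorried now — IRREDUCIBLE IN KIND: `stub_cylinderSurgeryFlowOrNull` (the Chodosh–Mantoulidis–Schulze Thm 1.13 + Daniels–Holgate surgery port to `N`; research;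
= the route's new item `CylinderSurgeryResolution`, stmt-18045, restricted to homotopy spheres and weakened by the null branch), `stub_cor15bFour` (published
named fact), `stub_certMid` (landed computational, kept sorried for the standard-axiom rule).  Crux ⇐ {one research port, one published theorem, one certified
computation}.
Idea card `Cruxes/CylinderRungTwo/Ideas/killing-flux.md` (ideator 1); triage r1-1/2/3: pass ×3 with the
common findings (i) the ideator's typed first lemma `Sketch.FluxIdentity` is FALSE as typed — witness
`CylinderSlice.twoSlices` + `f = z₅(z₅-1)` (`Triage.fluxIdentity_false`, three sorry-free proofs) —
repair: `[ConnectedSpace M]` (adopted below, and the defining function is replaced by the unit normal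
field itself, so no sign convention can leak); (ii) merge with `ground-state-relaxation` on the
immortal half (adopted: `stub_relaxation` is the RELAXATION statement, proved either by the card's
first-variation horizontality + conserved flux or by the two-sided maximum principle); (iii) the
load-bearing open step shared by every line is the finite-time port of Chodosh–Mantoulidis–Schulze /
Daniels-Holgate to `N` (isolated below as ONE named stub, `stub_finiteTimeHalf`).

THE CRUX (route `CylinderEntropy`, R = rung 2): a smooth embedding `ι` of a homotopy 4-sphere `M` into
`N = S⁴ × ℝ = {z ∈ ℝ⁶ | ∑_{i<5} zᵢ² = 1}` separating the two ends, with typed cylinder entropy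
`λ_cyl(range ι) < 4/e`, has `M ≃ₘ S⁴`.

THE LINE (the vertical angle `u = ⟪ν, e₅⟫ = ν₅` settles the immortal component). Mean curvature
flow of cross-sections IN `N` is typed extrinsically (`IsCylinderMCF`: embeddings `F t : M → ℝ⁶` with
image in `N`, unit normal `ν t` normal to `Σ_t = F t(M)` and tangent to `N`, and `∂F/∂t = -H ν` with
`H` the tree's `meanCurvature` of `(F t, ν t)` in `ℝ⁶`, which for `ν ⊥ n_N` IS the mean curvature of
`Σ_t ⊂ N`). Then `CylinderRungTwo` is the composition of five registered stubs:

* `stub_finiteTimeHalf` (THE FINITE-TIME HALF; shared with every line; research-level): from a thin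
  homotopy-sphere cross-section, mean curvature flow with surgery in `N` (generic perturbation below
  `4/e` ⇒ only `S³ × ℝ` necks and round `S⁴` points — CMS Cor. 1.5(b)/1.22(b) ported to `N`; CHHW
  canonical neighbourhoods hold in arbitrary ambients; every neck on a homotopy-sphere component
  separates it, so all split-off components are homotopy spheres dying at round points and the ROOT —
  the end-separating component, never extinct by the area floor — is diffeomorphic to `M`) produces,
  after its finitely many surgery times, an IMMORTAL SMOOTH flow `(F t)_{t ≥ T}` of cross-section
  embeddings of `M` itself, separating, with `λ_cyl < 4/e` (Hamilton monotonicity) and confined to the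
  slab of `ι` (avoidance with slices).
* `stub_fluxIdentity` (F — the line's lever, repaired): for a CONNECTED compact cross-section with a
  continuous unit normal `ν` tangent to `N`, `|∫_M ν₅ dμ| = vol(S⁴)`: the flux of the parallel Killing
  field `∂_s = e₅` through `M` (`Ω = ι_{e₅} dvol_N` is closed; divergence theorem on the region of `N`
  between `M` and a low slice; connectedness makes `N ∖ M` two-ended so the sign is constant).
* `stub_relaxation` (the immortal half; killing-flux T3 ≈ ground-state RELAXATION): an immortal smooth
  flow of compact connected separating cross-sections with `λ_cyl < 2` has `λ_cyl(F s) → 1`: area is a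
  Lyapunov function with floor `vol S⁴` (tree `hausdorffMeasure_sphere_le_of_separatesEnds`), so
  `∫∫ H² < ∞`; slab-tightness by avoidance; subsequential limits are stationary integral varifolds of
  mass in `[vol, 2 vol)`, horizontal by the first variation along `φ(s) ∂_s` (or squeezed between their
  top and bottom slices by the strong maximum principle), hence ONE slice with multiplicity ONE; backward
  Hamilton monotonicity moves every scale to `τ ≥ 1`, where `F̂` is continuous, and the slice has
  `λ_cyl = 1` (support item `SliceCalibration`, stmt-7634) ⇒ `λ_cyl(F s) < 1 + ε` for all large `s`.
* `stub_epsilonGraphical` (ε-REGULARITY TO A GRAPH, typed `FluxIdentity → EpsilonGraphical`): there is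
  a universal `ε > 0` such that one unit of smooth flow with `λ_cyl < 1 + ε` ends GRAPHICAL: White's
  local regularity (scales `< r₀ ≪ inj N = π`, where the typed kernel IS the Gaussian density ratio up
  to `1 + o(1)`) bounds `|A| ≤ C` on `M_t`; the FLUX IDENTITY turns the area excess
  `μH⁴(M_t) - μH⁴(S⁴) ≤ ε μH⁴(S⁴)` (tree `measure_ratio_le_cylEntropy`) into the tilt budget
  `∫_{M_t} (1 - u) = area - vol ≤ ε vol` (orient `ν` so that the flux is `+vol`), and `|∇u| ≤ |A| ≤ C`
  upgrades it to `u > 1/2` pointwise for `ε < ε(C)`; so the shadow `truncL ∘ F t : M → S⁴` is an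
  immersion, and it has ONE sheet because `∫ u = (#sheets) · vol(S⁴)` (area formula, `u` = Jacobian of
  the shadow) equals the flux `vol(S⁴)`.
* `stub_graphicalIsSphere` (differential topology): a compact connected `M` with a cross-section
  embedding whose shadow in `S⁴` is an injective immersion is diffeomorphic to `S⁴` (inverse function
  theorem: the shadow is open and closed, hence a bijective local diffeomorphism onto the connected
  `S⁴`).

The composition `cylinderRungTwo_of_parts` is pure logic plus `4/e ≤ 2` and the instances
`CompactSpace M`, `ConnectedSpace M` from `M ≃ₕ S⁴` (PROVED tree theorems); `CylinderRungTwo_of :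
CylinderRungTwo` concludes the crux BY NAME from the five registered stubs (`lean check` rc 0, sorries
only inside `stub_*`). NON-VACUITY OF THE INTERFACE (PROVED, standard axioms):
`isCylinderMCF_staticSlice` — the static slice `F t = sliceMap c`, `ν t = e₅` satisfies every clause
of `IsCylinderMCF`; in particular slices are minimal in the typed sense (`meanCurvature_sliceMap`:
`H = 0` from the tree's level-set formula for the linear height `z₅`), so the velocity convention
`∂F/∂t = -H ν` is consistent and the hypotheses of stubs 3–4 are satisfiable (the audit lists these
lemmas as `orphan`: they serve non-vacuity, not the composition).

DISPROOF USED (standing disprover refuter-cdisprove-stmt-SmoothPoincare4-7631-0; the body of its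
`Disproof.lean` is not mounted on this hub — read through its seven evidence notes, as the triagers did):
(i) SANDWICH `cylinderRungTwo_of_spc4` / `exotic_of_not_rung`: R is neither cheaply refutable nor
provable short of SPC4-for-thin-spheres — honoured: the SPC4-hard content sits in exactly one named
stub, `stub_finiteTimeHalf` (its conclusion, an immortal smooth flow of `M`, fails for a thin exotic
cross-section and holds for the slice of `S⁴` via the static flow), while stubs 2–5 are topology-free
analysis/differential topology; (ii) LOAD-BEARING HYPOTHESES (`rungWithout{Homotopy,Separation,Entropy,
Embedding}`, `rungWithoutHomotopyEntropy_false` with witness `S⁴ ⊔ S⁴ = twoSlices`,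
`two_le_cylEntropy_twoSlices`): `M ≃ₕ S⁴` is consumed by `stub_finiteTimeHalf` (simple connectivity:
necks separate) and, as compactness + connectedness, by stubs 2–5 (`[CompactSpace M] [ConnectedSpace M]`
— the flux identity is FALSE without connectedness, triage `fluxIdentity_false`); the entropy
hypothesis is consumed at `4/e` by stub 1 (genericity), at `2` by stub 3 (one sheet in the limit) and at
`1 + ε` by stub 4; separation by stubs 2–4 (degree one / area floor); the embedding by all;
(iii) PROVED FACTS reused, not re-stubbed: `measure_le_cylEntropy` = tree `measure_ratio_le_cylEntropy`,
`areaFloor` = tree `hausdorffMeasure_sphere_le_of_separatesEnds`, `one_le_cylEntropy_slice`. No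
`_false_without_` theorem is contradicted (no stub drops `M ≃ₕ S⁴`-compactness/connectedness where it
matters); no `Negative/` lemma has landed for this crux (`ledger crux ls`, 2026-08-16T00:3xZ); negatives
index for SmoothPoincare4: empty.
-/

noncomputable section

open MeasureTheory Set
open scoped Manifold ContDiff ENNReal Topology BigOperators ContinuousMap RealInnerProductSpace Gradient

namespace Summit.SmoothPoincare4.SmoothPoincare4.Cruxes.CylinderRungTwo.KillingFlux

open Literature.Geometry.Riemannian
open Literature.Geometry.Lorentzian Literature.Geometry.Lorentzian.PseudoRiemannianMetric
open Literature.Geometry.Riemannian.SphericalCylinderEntropy (cylKernel cylDensity cylEntropy truncL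
  measure_ratio_le_cylEntropy hausdorffMeasure_sphere_four_pos hausdorffMeasure_sphere_four_lt_top)
open Summit.SmoothPoincare4.SmoothPoincare4.Theses.CylinderEntropy (CylinderRungTwo SliceCalibration)

set_option linter.dupNamespace false

local notation "E4" => EuclideanSpace ℝ (Fin 4)
local notation "E5" => EuclideanSpace ℝ (Fin 5)
local notation "E6" => EuclideanSpace ℝ (Fin 6)

/-! ## The objects

LEAD RESHAPE r3: the vocabulary (`cylN`, `SeparatesEnds`, `IsGraphical`, `IsCylinderMCF`, the height
`heightL` and the PROVED static-slice API `contMDiff_sliceMap … isCylinderMCF_staticSlice`) now lives in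
the LANDED file `Theorems/CylinderEntropyCylinderRungTwoKillingFluxDefs.lean` (p93403, same namespace) and
is imported, not copied; the `HasLeviCivita` instance of the Euclidean metric of `ℝ⁶` comes from
`Literature.Geometry.Riemannian.GaussianShrinker` through that import. -/

open Literature.Geometry.Manifold.CylinderSlice (sliceMap axis padL castSucc_ne_five sum_sq_sliceMap
  range_sliceMap isSmoothEmbedding_sliceMap separatesEnds_of_slice_subset sliceMap_eq_comp padL_apply_last)

/-! ## Vocabulary of the finite-time half (lead reshape r15): `IsCylinderMCFOn`, `CylNeckSurgeryResolvable` and their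
non-vacuity live in the LANDED vocabulary file `Theorems/CylinderEntropyCylinderRungTwoSurgeryDefs.lean` (p136582, same namespace),
imported above — the inlined copy of r15 is gone (r16), exactly as the first vocabulary block at r3. -/

/-! ## Statements of the stubs -/

/-- Statement of `stub_finiteTimeHalf` — **THE FINITE-TIME HALF** (the open step shared by every line
of this crux; size XL, research-level). For a homotopy 4-sphere `M` and a smooth embedding `ι` into `N`
separating the ends with `λ_cyl(range ι) < 4/e`, there is an IMMORTAL SMOOTH mean curvature flow
`(F t)_{t ≥ T}` of cross-section embeddings OF `M` ITSELF in `N`, separating the ends, with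
`λ_cyl(range (F t)) < 4/e`, confined to the slab of `ι` up to one unit of height. Intended construction:
CMS generic perturbation of `ι` (λ continuous under small `C^∞` graphs, so still `< 4/e`) + mean
curvature flow with Daniels-Holgate surgery in `N`: Hamilton monotonicity ⇒ blow-ups are Euclidean
shrinkers of entropy `< 4/e`; CMS density drop §§3–5 ported to `N` ⇒ generically only multiplicity-one
`S⁴` points and `S³ × ℝ` necks (strictly below `4/e` the bubble sheet never enters, CMS II §1.2; CHHW
Thm 1.17 holds in arbitrary ambients); every neck on a homotopy-sphere component separates it into two
homotopy balls, so split-off components are homotopy spheres of area `< 0.4715 vol S⁴`, which cannot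
reach a slice and die at round points (hence are `S⁴`), while the ROOT (end-separating, area `≥ vol S⁴`,
White 1995 Thm 1(i)) never dies; each surgery at fixed scale costs a quantum of area, so there are
finitely many, and after the last one the root flows smoothly forever and is diffeomorphic to
`M # (spheres) ≅ M`. True for `M = S⁴` and the slice (static flow); false for a thin exotic cross-section
(this is where SPC4-hardness lives, cdisprove sandwich).
[cite: ChodoshMantoulidisSchulze2025, Cor. 1.5 (b), Cor. 1.22 (b), §§3–5]
[cite: DanielsHolgate2022, Thm. 1.1] [cite: ChoiHaslhoferHershkovitsWhite2022, Thm. 1.17, Cor. 1.18] -/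
def FiniteTimeHalf : Prop :=
  ∀ (M : Type) [TopologicalSpace M] [T2Space M] [SecondCountableTopology M]
    [ChartedSpace E4 M] [IsManifold (𝓡 4) ∞ M],
    M ≃ₕ Metric.sphere (0 : E5) 1 →
    ∀ ι : M → E6, Manifold.IsSmoothEmbedding (𝓡 4) (𝓡 6) ∞ ι →
    (∀ x, ∑ i : Fin 5, ι x (Fin.castSucc i) ^ 2 = 1) → SeparatesEnds (Set.range ι) →
    cylEntropy (Set.range ι) < ENNReal.ofReal (4 / Real.exp 1) →
    ∃ (F : ℝ → M → E6) (ν : ℝ → M → E6) (T : ℝ), IsCylinderMCF M F ν T ∧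
      (∀ t, T ≤ t → SeparatesEnds (Set.range (F t))) ∧
      (∀ t, T ≤ t → cylEntropy (Set.range (F t)) < ENNReal.ofReal (4 / Real.exp 1)) ∧
      (∀ t, T ≤ t → ∀ x, ∃ y y' : M, ι y 5 - 1 ≤ F t x 5 ∧ F t x 5 ≤ ι y' 5 + 1)

/-- Statement of `stub_fluxIdentity` — **THE FLUX IDENTITY** (the card's first lemma, REPAIRED per
triage r1-1/2/3: `ConnectedSpace M`, and the defining function replaced by the unit normal field itself;
size L). For a compact CONNECTED `4`-manifold `M`, a smooth embedding `ι : M → N` separating the ends,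
and any continuous unit normal field `ν` along `ι` tangent to `N`, the flux of the vertical Killing field
`e₅ = ∂_s` through `M` is `± vol(S⁴)`:
`|∫_M ν₅ d(ι^* μH⁴)| = μH⁴(S⁴ ⊂ ℝ⁵)` (`ι^* μH⁴ = Measure.comap ι μH[4]`, the induced area measure).
Proof route: `N ∖ ι(M)` has exactly two components `U₋ ∋` lower end, `U₊ ∋` upper end (connected closed
two-sided hypersurface of `N ≅ S⁵ ∖ {2 points}` + separation), `ν` points into `U₊` everywhere or into
`U₋` everywhere (continuity on connected `M`), and the divergence theorem for the parallel field `e₅`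
(`div_N e₅ = 0`) on `U₋ ∩ {z₅ ≥ -R'}` gives `∫_M ⟪e₅, ν_out⟫ = ∫_{S⁴ × {-R'}} 1 = vol(S⁴)`;
equivalently Stokes for the closed 4-form `Ω = ι_{e₅} dvol_N = pr₁^* dvol_{S⁴}`. FALSE without
connectedness (two slices with parallel normals: flux `2 vol` or `0`; `Triage.fluxIdentity_false`).
Corollaries (not stubs): `area(M) - vol(S⁴) = ∫_M (1 - u) ≥ 0` with equality iff `M` is a slice
(`OnlySlicesAtTheFloor`), and the deficit is a Lyapunov function along the flow with
`∫∫ H² ≤ D(T)`. [folklore] -/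
def FluxIdentity : Prop :=
  ∀ (M : Type) [TopologicalSpace M] [T2Space M] [SecondCountableTopology M]
    [ChartedSpace E4 M] [IsManifold (𝓡 4) ∞ M] [CompactSpace M] [ConnectedSpace M]
    [MeasurableSpace M] [BorelSpace M]
    (ι : M → E6), Manifold.IsSmoothEmbedding (𝓡 4) (𝓡 6) ∞ ι →
    (∀ x, ∑ i : Fin 5, ι x (Fin.castSucc i) ^ 2 = 1) → SeparatesEnds (Set.range ι) →
    ∀ ν : M → E6, Continuous ν → (euclideanMetric E6).IsUnitNormal (𝓡 4) ι ν 1 →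
      (∀ x, ∑ i : Fin 5, ν x (Fin.castSucc i) * ι x (Fin.castSucc i) = 0) →
      |∫ x, ν x 5 ∂(Measure.comap ι (μH[4] : Measure E6))| =
        (μH[4] (Metric.sphere (0 : E5) 1)).toReal

/-- Statement of `stub_relaxation` — **RELAXATION OF THE IMMORTAL CROSS-SECTION TO THE GROUND STATE**
(the `t → ∞` half of the crux; killing-flux T3 merged with `ground-state-relaxation`, as all three
triagers recommend; size L). An immortal smooth mean curvature flow in `N` of compact connected
cross-sections separating the ends, with `λ_cyl < 2` along the flow, has `λ_cyl(F s) → 1`: for every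
`ε > 0`, `λ_cyl(range (F s)) < 1 + ε` for all `s ≥ t₀`. Proof route: area is non-increasing with floor
`vol(S⁴)` (tree `hausdorffMeasure_sphere_le_of_separatesEnds`) ⇒ `∫_T^∞ ∫ H² ≤ area(T) - vol < ∞`;
`M_t` stays in a slab (avoidance with the static slices); time-translates converge (Brakke/Ilmanen
compactness in `N`, Allard) to a STATIC stationary integral varifold `V` of mass `A_∞ ∈ [vol, 2 vol)`
(no mass loss: Brakke's inequality with `∫∫H² → 0` on unit windows); `V` is horizontal — first variation
along `X = φ(s) ∂_s`, `Hess_N s = 0`, gives `∫ φ'(s) |∂_s^⊤|² dV = 0` for all `φ` — hence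
`V = ∑ mᵢ [S⁴ × {sᵢ}]` (equivalently: `V` contains the top and bottom slices of its support by the
strong maximum principle against the totally geodesic slice foliation), and `A_∞ < 2 vol` forces ONE
slice with multiplicity ONE; backward Hamilton monotonicity `F̂_{p,τ}(M_s) ≤ F̂_{p,τ+1}(M_{s-1})`
(Harnack matrix of the product kernel `≥ 0`, numerically coercive: triage r1-2/3) moves every scale to
`τ ≥ 1`, where `F̂` is an equicontinuous family on the slab with tails controlled by the tree's
`one_sub_tail_le_zonal`, so `limsup_s λ_cyl(M_s) ≤ λ_cyl(slice) = 1` by contradiction along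
subsequences. LEANS ON the route's support item `SliceCalibration` (stmt-SmoothPoincare4-7634,
`λ_cyl(slice) ≤ 1`; its `≥ 1` half is the tree's `one_le_cylEntropy_slice`): if 7634 is refuted the
thresholds here and in `EpsilonGraphical` restate 1:1 with the corrected normalisation, like every
route item. [cite: Allard1972, §6 (compactness of integral varifolds)]
[cite: White2005, Thm. 1.1 (local regularity, Riemannian ambient)] [cite: BorisenkoMiquel2012, Thm. 1] -/
def Relaxation : Prop :=
  ∀ (M : Type) [TopologicalSpace M] [T2Space M] [SecondCountableTopology M]
    [ChartedSpace E4 M] [IsManifold (𝓡 4) ∞ M] [CompactSpace M] [ConnectedSpace M]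
    (F : ℝ → M → E6) (ν : ℝ → M → E6) (T : ℝ), IsCylinderMCF M F ν T →
    (∀ t, T ≤ t → SeparatesEnds (Set.range (F t))) →
    (∀ t, T ≤ t → cylEntropy (Set.range (F t)) < 2) →
    ∀ ε : ℝ, 0 < ε → ∃ t₀ : ℝ, T ≤ t₀ ∧
      ∀ s, t₀ ≤ s → cylEntropy (Set.range (F s)) < ENNReal.ofReal (1 + ε)

/-- Statement half of `stub_epsilonGraphical` — **ε-REGULARITY TO A GRAPH** (size L). There is a
UNIVERSAL `ε > 0` such that: if a smooth mean curvature flow in `N` of compact connected cross-sections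
has, during one unit of time `[t-1, t]`, separating time-slices with `λ_cyl < 1 + ε`, then `F t` is
GRAPHICAL (`IsGraphical`: the shadow in `S⁴` is an injective immersion). The registered stub is
`FluxIdentity → EpsilonGraphical`; proof route: (1) curvature — at scales `τ ≤ r₀² ≪ inj(N)² = π²` the
typed kernel `vol(S⁴) H_{S⁴} G_ℝ` is the `4`-dimensional Gaussian density of the 5-manifold `N` up to
`1 + o(1)` (Minakshisundaram–Pleijel; intrinsic vs chordal distance in `N ⊂ ℝ⁶`), so `λ_cyl < 1 + ε`
on `[t-1, t]` feeds White's local regularity theorem (mean curvature flow in a Riemannian manifold /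
with bounded forcing after `N ⊂ ℝ⁶`) and gives `|A| ≤ C` on `M_t`, `C` universal; (2) tilt — by the
area bound `μH⁴(M_t) ≤ (1+ε) μH⁴(S⁴)` (tree `measure_ratio_le_cylEntropy`) and the FLUX IDENTITY with
`ν` oriented so that the flux is `+vol(S⁴)`, `∫_{M_t} (1 - u) dμ = area - vol ≤ ε vol(S⁴)` with
`1 - u ≥ 0`, and `|∇u| ≤ |A| ≤ C` turns this `L¹` budget into `u > 1/2` pointwise once
`ε vol(S⁴) < (1/4) · inf_x μ(B^{M_t}_{1/4C}(x))` — so `e₅ ∉ TΣ_t` and the shadow is an immersion;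
(3) one sheet — `u` is the Jacobian of the shadow `M_t → S⁴`, a local diffeomorphism of the compact `M`
with constant sheet number `k`, and `∫ u = k vol(S⁴)` (area formula) equals the flux `vol(S⁴)`, so
`k = 1` and the shadow is injective. A STATIC version (no flow) is false for every `ε` (a steep wrinkle
of tiny area), which is why one unit of flow is part of the hypothesis.
[cite: White2005, Thm. 1.1 and §§3–4] [cite: Allard1972, §8 (regularity)] -/
def EpsilonGraphical : Prop :=
  ∃ ε : ℝ, 0 < ε ∧
    ∀ (M : Type) [TopologicalSpace M] [T2Space M] [SecondCountableTopology M]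
      [ChartedSpace E4 M] [IsManifold (𝓡 4) ∞ M] [CompactSpace M] [ConnectedSpace M]
      (F : ℝ → M → E6) (ν : ℝ → M → E6) (T : ℝ), IsCylinderMCF M F ν T →
      ∀ t : ℝ, T + 1 ≤ t →
        (∀ s ∈ Set.Icc (t - 1) t, SeparatesEnds (Set.range (F s))) →
        (∀ s ∈ Set.Icc (t - 1) t, cylEntropy (Set.range (F s)) < ENNReal.ofReal (1 + ε)) →
        IsGraphical M (F t)

/-- Statement of `stub_graphicalIsSphere` — **A GRAPHICAL CROSS-SECTION IS A STANDARD SPHERE**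
(differential topology; size M, provable now). If `M` is compact and connected and `ι : M → N` is a
smooth embedding whose shadow `truncL ∘ ι : M → ℝ⁵` is an injective immersion, then `M ≃ₘ S⁴`:
the shadow lands in `S⁴` (`∑_{i<5} (ι x)ᵢ² = 1`), co-restricts to a smooth injective map `M → S⁴`
with injective — hence bijective — differential (Mathlib `ContMDiff.codRestrict_sphere`,
`mfderiv_coe_sphere_injective`), which is a local diffeomorphism (inverse function theorem, tree
`Literature/Geometry/Manifold/InverseFunctionTheorem`, `OpenEmbeddingCriterion`), so its image is open
and compact in the connected `S⁴`: a bijective local diffeomorphism, i.e. a diffeomorphism.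
[cite: HirschDT1976, Ch. 1 §3 Thm. 3.1; Ch. 2 §1] -/
def GraphicalIsSphere : Prop :=
  ∀ (M : Type) [TopologicalSpace M] [T2Space M] [SecondCountableTopology M]
    [ChartedSpace E4 M] [IsManifold (𝓡 4) ∞ M] [CompactSpace M] [ConnectedSpace M]
    (ι : M → E6), Manifold.IsSmoothEmbedding (𝓡 4) (𝓡 6) ∞ ι →
    (∀ x, ∑ i : Fin 5, ι x (Fin.castSucc i) ^ 2 = 1) → IsGraphical M ι →
    Nonempty (M ≃ₘ⟮𝓡 4, 𝓡 4⟯ Metric.sphere (0 : E5) 1)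

/-! ## The finer statements behind stubs 3–4 (lead reshape r2, from the wave-1 workers' audits) -/

/-- **Hamilton's monotonicity formula in `N = S⁴ × ℝ` for the typed density** (the first missing link
behind `Relaxation`, isolated by the wave-1 worker of `stub_relaxation`). Along a smooth mean curvature
flow of closed cross-sections of `N`, for every centre `p ∈ N`, scale `τ > 0` and lag `σ ≥ 0`:
`F̂_{p,τ}(M_{s+σ}) ≤ F̂_{p,τ+σ}(M_s)` (`s ≥ T`).  WHY TRUE: the typed `cylDensity (range (F t)) p (t₀ - t)`
is, up to the constant `vol(S⁴)(4π)^{1/2}/μH⁴(S⁴)`, Hamilton's quantity `(t₀ - t)^{(n-m)/2} ∫_{M_t} k`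
(`n - m = 5 - 4 = 1`) for the backward heat kernel `k = H_{S⁴} ⊗ G_ℝ` of `N` centred at `(p, t₀)`;
Hamilton, *Monotonicity formulas for parabolic flows on manifolds*, Comm. Anal. Geom. 1 (1993) 127–137,
Thm. 4.1 (MCF case) makes it non-increasing once the Harnack matrix
`∇∇k - ∇k ⊗ ∇k / k + k g/(2(t₀ - t))` is non-negative; for the PRODUCT kernel this matrix is block
diagonal: the `ℝ` block of the Gaussian vanishes identically and the `S⁴` block is Hamilton's *A matrix
Harnack estimate for the heat equation*, ibid. 113–126 (compact, `sec ≥ 0`, `∇Ric = 0`); the same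
monotonicity is A. Sun, J. Geom. Anal. 31 (2021) = arXiv:1912.09431, Thm. 1.5, for the intrinsic
entropy `λ_Sun = (4π)^{-1/2} λ_cyl`.  Numerically the `S⁴` block is coercive (`≥ 0.4147` for `τ ≤ 1`;
`HarnackNumericsK3.md`, triage r1-2/3).  The Euclidean codimension-one analogue IS in the tree
(`IsClassicalMCF.antitoneOn_gaussianIntegral`, `HuiskenMonotonicity.lean`); the port needs the area
formula `μH[4]⌊range (F t) = (F t)_# vol_{g_t}` for embeddings into `ℝ⁶`, `∂_t dμ = -H² dμ`, and the
term-wise calculus of the Gegenbauer series `cylKernel` for `0 < τ` (tree summability: `τ ≥ 1` only).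
[size XL] -/
def HamiltonMonotonicity : Prop :=
  ∀ (M : Type) [TopologicalSpace M] [T2Space M] [SecondCountableTopology M]
    [ChartedSpace E4 M] [IsManifold (𝓡 4) ∞ M] [CompactSpace M]
    (F : ℝ → M → E6) (ν : ℝ → M → E6) (T : ℝ), IsCylinderMCF M F ν T →
    ∀ p : E6, ∑ i : Fin 5, p (Fin.castSucc i) ^ 2 = 1 →
    ∀ s σ τ : ℝ, T ≤ s → 0 ≤ σ → 0 < τ →
      cylDensity (Set.range (F (s + σ))) p τ ≤ cylDensity (Set.range (F s)) p (τ + σ)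

/-- **Area dissipation** (input (a) of large-scale relaxation; classical `d/dt μH⁴(M_t) = -∫ H² ≤ 0`):
area is non-increasing along a smooth cylinder flow of a closed cross-section.  Euclidean codimension-one
version in the tree: `IsClassicalMCF.hasDerivAt_area` (`MCFAreaEvolution.lean`, with
`MCFMetricEvolution.lean`: `∂_t √det g_t = -H² √det g_t`); the port to the codimension-two-in-`ℝ⁶`
flow `IsCylinderMCF` needs the area formula `μH[4]⌊range (F t) = c₄ · (F t)_# vol_{g_t}` (tree
`lintegral_comp_riemannianMeasure_induced`, `riemannianMeasure_induced_apply`). [size L] -/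
def AreaDissipation : Prop :=
  ∀ (M : Type) [TopologicalSpace M] [T2Space M] [SecondCountableTopology M]
    [ChartedSpace E4 M] [IsManifold (𝓡 4) ∞ M] [CompactSpace M]
    (F : ℝ → M → E6) (ν : ℝ → M → E6) (T : ℝ), IsCylinderMCF M F ν T →
    AntitoneOn (fun t => μH[4] (Set.range (F t))) (Set.Ici T)

/-- **Slab confinement** (input (b) of large-scale relaxation; maximum principle for the height
`z₅ ∘ F t`, which solves the heat equation on `(M, g_t)` because the `n_N`-component of the mean
curvature vector of `Σ_t ⊂ ℝ⁶` has vanishing last coordinate; at a spatial maximum `ν = ±e₅` and the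
tree's sign convention gives `∂_t z₅ = -H ν₅ ≤ 0`): the flow stays in the height slab of its initial
cross-section.  Euclidean comparison principle in the tree: `IsClassicalMCF.disjoint_range`
(`MCFComparisonPrinciple.lean`); maximum-principle tools: `MaximumPrincipleAtMaxima.lean`,
`HamiltonMaximumPrinciple*.lean`. [size L] -/
def SlabConfinement : Prop :=
  ∀ (M : Type) [TopologicalSpace M] [T2Space M] [SecondCountableTopology M]
    [ChartedSpace E4 M] [IsManifold (𝓡 4) ∞ M] [CompactSpace M]
    (F : ℝ → M → E6) (ν : ℝ → M → E6) (T : ℝ), IsCylinderMCF M F ν T →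
    ∀ t, T ≤ t → ∀ x : M, ∃ y y' : M, F T y 5 ≤ F t x 5 ∧ F t x 5 ≤ F T y' 5

/-- **Large-scale relaxation** (the GMT content behind `Relaxation`): for an immortal smooth flow of
compact connected separating cross-sections with `λ_cyl < 2`, for every `ε > 0` eventually ALL densities
at scales `τ ≥ 1` are `≤ 1 + ε`, uniformly in the centre `p ∈ N`.  Classical chain: (a) area dissipation
`∫_T^∞ ∫ H² ≤ area(M_T) - vol S⁴` (floor = tree `hausdorffMeasure_sphere_le_of_separatesEnds`); (b) slab
confinement (the height `z₅ ∘ F t` solves the heat equation on `(M, g_t)`); (c) every subsequential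
Radon-measure limit of `μH[4]⌊range (F s)`, `s → ∞`, is `μH[4]⌊(S⁴ × {c})` for some `c` in the slab
(Allard 1972 §6.4 integral compactness at good times + Brakke's window estimate; stationary integral
varifolds of `N` with compact support are HORIZONTAL — first variation along `φ(z₅) ∂₅`, `∇∂₅ = 0` ⇒
`∫ φ' |∂₅^⊤|² dV = 0` — hence finite sums of slices, and mass `∈ [vol, 2 vol)` (PROVED floor + tree
`measure_ratio_le_cylEntropy`) leaves ONE slice of multiplicity one); (d) `{cylKernel p τ | p ∈ N, τ ≥ 1}`
is uniformly bounded and equicontinuous on slabs (tree `abs_term_le`, `one_sub_tail_le_zonal`); (e)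
`λ_cyl(slice) ≤ 1` (support item `SliceCalibration`, stmt-SmoothPoincare4-7634 — provably NECESSARY:
the worker's `cylEntropy_slice_le_one_of_relaxation`). [size XL]
[cite: Allard1972, §6.4 (compactness of integral varifolds)] -/
def LargeScaleRelaxation : Prop :=
  ∀ (M : Type) [TopologicalSpace M] [T2Space M] [SecondCountableTopology M]
    [ChartedSpace E4 M] [IsManifold (𝓡 4) ∞ M] [CompactSpace M] [ConnectedSpace M]
    (F : ℝ → M → E6) (ν : ℝ → M → E6) (T : ℝ), IsCylinderMCF M F ν T →
    (∀ t, T ≤ t → SeparatesEnds (Set.range (F t))) →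
    (∀ t, T ≤ t → cylEntropy (Set.range (F t)) < 2) →
    ∀ ε : ℝ, 0 < ε → ∃ t₀ : ℝ, T ≤ t₀ ∧
      ∀ s, t₀ ≤ s → ∀ p : E6, ∑ i : Fin 5, p (Fin.castSucc i) ^ 2 = 1 →
        ∀ τ : ℝ, 1 ≤ τ → cylDensity (Set.range (F s)) p τ ≤ ENNReal.ofReal (1 + ε)

/-- **Vertical gap** (the analytic content behind `EpsilonGraphical`, isolated by the wave-1 worker of
`stub_epsilonGraphical`): a universal `ε > 0` such that after one unit of smooth cylinder flow with
separating `(1+ε)`-thin time slices the unit normal is nowhere horizontal, `ν t x 5 ≠ 0`.  Classical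
chain: (1a) White-type ε-regularity — at scales `τ ≤ r₀² ≪ inj(N)² = π²` the typed kernel
`vol(S⁴) H_{S⁴} G_ℝ` is the `4`-dimensional Gaussian density of `N` up to `1 + o(1)`
(Minakshisundaram–Pleijel), so `λ_cyl < 1 + ε` on `[t-1, t]` bounds the second fundamental form
`|A| ≤ C` on `M_t`, `C` universal (White, Ann. of Math. 161 (2005), Thm. 3.5/§4, flows up to the final
time); (1b) tilt gap — `∫_{M_t} (1 - |ν₅|) = area - ∫ |Jac(shadow)| ≤ (1+ε) vol - vol` (tree
`measure_ratio_le_cylEntropy`, area formula, shadow onto `S⁴` by separation), `|∇ν₅| ≤ |A| ≤ C` and a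
universal lower area bound for intrinsic balls ⇒ `|ν₅| > 1/2`.  The worker's file proves
`verticalGap_of : CurvatureBound → TiltGap → VerticalGap` sorry-free (work/stubs/StubEpsilonGraphical.lean).
[size XL] [cite: White2005, Thm. 3.5 and §4] -/
def VerticalGap : Prop :=
  ∃ ε : ℝ, 0 < ε ∧
    ∀ (M : Type) [TopologicalSpace M] [T2Space M] [SecondCountableTopology M]
      [ChartedSpace E4 M] [IsManifold (𝓡 4) ∞ M] [CompactSpace M] [ConnectedSpace M]
      (F : ℝ → M → E6) (ν : ℝ → M → E6) (T : ℝ), IsCylinderMCF M F ν T →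
      ∀ t : ℝ, T + 1 ≤ t →
        (∀ s ∈ Set.Icc (t - 1) t, SeparatesEnds (Set.range (F s))) →
        (∀ s ∈ Set.Icc (t - 1) t, cylEntropy (Set.range (F s)) < ENNReal.ofReal (1 + ε)) →
        ∀ x : M, ν t x 5 ≠ 0

/-- **Area to the floor** (lead reshape r6: THE GMT core of the immortal half, replacing
`LargeScaleRelaxation`).  Along an immortal smooth cylinder flow of a compact connected cross-section whose
time slices separate the ends and have `λ_cyl < 2`, the area returns to the floor: for every `ε > 0` some
time slice has `μH⁴(M_t) ≤ (1+ε) μH⁴(S⁴)` (and then all later ones, by `AreaDissipation`).  Classical chain: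
`∫_T^∞∫ H² ≤ μH⁴(M_T) - vol S⁴ < ∞` (area dissipation + floor), so along good times `∫_{M_t} H² → 0`;
slab confinement makes the family tight; a subsequential varifold limit `V` is stationary (first variation
`= -∫ H⟨ν, X⟩ → 0`) and INTEGRAL (Allard's compactness theorem); stationary varifolds of `N` with compact
support are HORIZONTAL (first variation along `φ(z₅) e₅`, `∇e₅ = 0`, gives `∫ φ'(z₅)|e₅^⊤|² dV = 0`), hence
`V = ∑ mᵢ [S⁴ × {cᵢ}]` (disintegration over heights + constancy on `S⁴`), and mass `< 2 vol S⁴`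
(`measure_ratio_le_cylEntropy`) with `≥ vol S⁴` (floor) leaves ONE slice of multiplicity ONE: the mass,
which converges by tightness, tends to `vol S⁴`.  EQUIVALENT to `Relaxation` given Hamilton monotonicity
(`stub_relaxationOfAreaToFloor` below and `measure_ratio_le_cylEntropy`).  True for the static slice
(`μH⁴(slice) = μH⁴(S⁴)`, tree `hausdorffMeasure_range_sliceMap`). [size XL; Allard 1972 §6.4, Brakke 1978 §4,
Ilmanen 1994 §§6–7] [cite: Allard1972, §6.4] -/
def AreaToFloor : Prop :=
  ∀ (M : Type) [TopologicalSpace M] [T2Space M] [SecondCountableTopology M]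
    [ChartedSpace E4 M] [IsManifold (𝓡 4) ∞ M] [CompactSpace M] [ConnectedSpace M]
    (F : ℝ → M → E6) (ν : ℝ → M → E6) (T : ℝ), IsCylinderMCF M F ν T →
    (∀ t, T ≤ t → SeparatesEnds (Set.range (F t))) →
    (∀ t, T ≤ t → cylEntropy (Set.range (F t)) < 2) →
    ∀ ε : ℝ, 0 < ε → ∃ t : ℝ, T ≤ t ∧
      μH[4] (Set.range (F t)) ≤ ENNReal.ofReal (1 + ε) * μH[4] (Metric.sphere (0 : E5) 1)

/-- **ε-regularity for thin cylinder flows** (lead reshape r6: the White 2005 core behind `VerticalGap`,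
typed by the two outputs the tilt-gap argument consumes).  There are universal `ε, C, c, r₀ > 0` such that
after one unit of smooth cylinder flow of a compact connected cross-section with separating `(1+ε)`-thin time
slices on `[t-1, t]`: (a) the vertical component of the unit normal is `C`-Lipschitz for the extrinsic
(chordal) distance at scale `r₀`, `|ν₅(x) - ν₅(y)| ≤ C ‖F t x - F t y‖` whenever `‖F t x - F t y‖ ≤ r₀`;
(b) lower area bound `c r⁴ ≤ μH⁴(M_t ∩ B(F t x, r))` for `0 < r ≤ r₀`.  WHY TRUE: at scales
`τ ≤ r₁² ≪ inj(N)² = π²` the typed kernel `vol(S⁴) H_{S⁴} ⊗ e^{-s²/4τ}` is the 4-dimensional Gaussian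
density of `N ⊂ ℝ⁶` up to `1 + o(1)` (Minakshisundaram–Pleijel), so `λ_cyl < 1+ε` on `[t-1,t]` puts the
flow in White's regime (Ann. of Math. 161 (2005), Thm 3.5 and the Riemannian remark of §4; `N ⊂ ℝ⁶` has
bounded geometry): `|A| ≤ C₁` on `M_t` with `C₁` universal; two sheets within `r₀ = 1/(100 C₁)` of each
other would give a density `≈ 2` at scale `(10 r₀)²`, so `M_t ∩ B(F t x, 10 r₀)` is ONE graph with small
gradient over its tangent plane, on which `|∇ν| ≤ |A|` integrates to (a) with `C = 2C₁` and whose area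
gives (b).  True for the static slice (`ν ≡ e₅`; spherical caps).  A STATIC version (no unit of flow) is
false for every `ε` (a steep wrinkle of tiny area). [size XL] [cite: White2005, Thm. 3.5 and §4] -/
def EpsilonRegularity : Prop :=
  ∃ ε : ℝ, 0 < ε ∧ ∃ C : ℝ, 0 < C ∧ ∃ c : ℝ, 0 < c ∧ ∃ r₀ : ℝ, 0 < r₀ ∧
    ∀ (M : Type) [TopologicalSpace M] [T2Space M] [SecondCountableTopology M]
      [ChartedSpace E4 M] [IsManifold (𝓡 4) ∞ M] [CompactSpace M] [ConnectedSpace M]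
      (F : ℝ → M → E6) (ν : ℝ → M → E6) (T : ℝ), IsCylinderMCF M F ν T →
      ∀ t : ℝ, T + 1 ≤ t →
        (∀ s ∈ Set.Icc (t - 1) t, SeparatesEnds (Set.range (F s))) →
        (∀ s ∈ Set.Icc (t - 1) t, cylEntropy (Set.range (F s)) < ENNReal.ofReal (1 + ε)) →
        (∀ x y : M, ‖F t x - F t y‖ ≤ r₀ → |ν t x 5 - ν t y 5| ≤ C * ‖F t x - F t y‖) ∧
        (∀ x : M, ∀ r : ℝ, 0 < r → r ≤ r₀ →
          ENNReal.ofReal (c * r ^ 4) ≤ μH[4] (Set.range (F t) ∩ Metric.ball (F t x) r))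

/-- **One sheet** (differential topology; provable now): a compact connected cross-section whose shadow
`truncL ∘ ι : M → ℝ⁵` is an immersion has INJECTIVE shadow — the shadow co-restricts to a local
diffeomorphism `M → S⁴` (inverse function theorem, equal dimensions), a finite covering (compactness),
trivial because `S⁴` is simply connected and `M` is connected; equivalently, via the landed FLUX
IDENTITY and the area formula for the shadow (`∫ ν₅ = #sheets · vol S⁴ = ± vol S⁴`), the sheet number is
one. [size M–L] [cite: HirschDT1976, Ch. 1 §3 Thm. 3.1] -/
def OneSheet : Prop :=
  ∀ (M : Type) [TopologicalSpace M] [T2Space M] [SecondCountableTopology M]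
    [ChartedSpace E4 M] [IsManifold (𝓡 4) ∞ M] [CompactSpace M] [ConnectedSpace M]
    (ι : M → E6), Manifold.IsSmoothEmbedding (𝓡 4) (𝓡 6) ∞ ι →
    (∀ x, ∑ i : Fin 5, ι x (Fin.castSucc i) ^ 2 = 1) →
    (∀ x : M, Function.Injective (mfderiv (𝓡 4) (𝓡 5) ((truncL : E6 → E5) ∘ ι) x)) →
    Function.Injective ((truncL : E6 → E5) ∘ ι)

/-! ## Registered stubs (r21: sorried = 1'' `stub_cylinderSurgeryFlowOrNull` (lead, research; null branch = never separates + pocket), 6 `stub_cor15bFour` (named fact),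
6' `stub_certMid` (landed computational); PROVED: 3b' `stub_areaToFloor` (= item 17197, `areaToFloor` p144604), `nullSurvivorsDie_pocket` (r21); DERIVED: 1 `stub_finiteTimeHalf`,
1' `stub_cylinderSurgeryFlow`, `nullSurvivorsDie_pocket` (r19/r20; supersedes r17's `stub_nullSurvivorsDie`); 2, 3a, 3b-i, 3b-ii, 3b'', 4a-ii, 4b, 5 and the c6 rigidity layer LANDED; Allard / White paths hypothesis-style) -/




/-- **NULL SURVIVORS DIE — PROVED** (r21, lead c7; `helper_nullSurvivorsDiePocket`, `Theorems/CylinderEntropyCylinderRungTwoNullSurvivorsDie.lean`):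
there is no immortal smooth cylinder flow of a compact connected cross-section with `λ_cyl < 2` along the flow whose slices never separate the ends and
each have a POCKET (a point of the complement in `N` that cannot be joined, inside the complement, to the lower end).  Proof = the proof of the immortal
half `areaToFloor` (17197, p144604: Besicovitch good set, stacking, `shadow_injOn_of_good`) with the uniform upper Gaussian density taken from the PARABOLIC
AREA FLOOR (`helper_upperGaussianDensityLateOfFloor` p148054 ⇐ `helper_volLeAreaAlongCylinderFlow` p138658) instead of separation, and a new DEGREE-ZERO
endgame: crossing parity `N₊ = N₋` a.e. (`helper_crossingParityOfPocket` p144812, from the Jordan–Brouwer-free crossing count of wave 1: `helper_farPointsJoined`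
p141572, `helper_sidesDifferOfPocket` p143000, `helper_fluxZeroOfPocket` p143625) makes a set with injective shadow DOMINATED BY ITS COMPLEMENT
(`helper_parityCounting`, `(1-ξ) μ(G) ≤ μ(Gᶜ)`), so `κ vol ≤ μ(P) ≤ μ(G) + μ(Gᶜ) < κ vol`.  (r18–r20 derived this from a static stub `stub_nullThinStatic` through
the glues p141073 / p143711 / p144284; the stub is no longer needed and was deleted at r21.)
[cite: Allard1972, §6] [cite: HirschDT1976, Ch. 4 §4 and Ch. 5 §1] [cite: Hamilton1993, Thm. 4.1] -/
theorem nullSurvivorsDie_pocket :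
    ¬ ∃ (P : Type) (_ : TopologicalSpace P) (_ : T2Space P) (_ : SecondCountableTopology P)
        (_ : ChartedSpace (EuclideanSpace ℝ (Fin 4)) P) (_ : IsManifold (𝓡 4) ∞ P) (_ : CompactSpace P)
        (_ : ConnectedSpace P) (_ : MeasurableSpace P) (_ : BorelSpace P)
        (F : ℝ → P → EuclideanSpace ℝ (Fin 6)) (ν : ℝ → P → EuclideanSpace ℝ (Fin 6)) (T : ℝ),
        IsCylinderMCF P F ν T ∧ (∀ t, T ≤ t → cylEntropy (Set.range (F t)) < 2) ∧
          (∀ t, T ≤ t → ¬ SeparatesEnds (Set.range (F t))) ∧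
          (∀ t, T ≤ t → ∃ (z : EuclideanSpace ℝ (Fin 6)) (R : ℝ), ∑ i : Fin 5, z (Fin.castSucc i) ^ 2 = 1 ∧
            z ∉ Set.range (F t) ∧ ∀ b : EuclideanSpace ℝ (Fin 6), ∑ i : Fin 5, b (Fin.castSucc i) ^ 2 = 1 → b 5 ≤ -R →
              ¬ JoinedIn ({z : EuclideanSpace ℝ (Fin 6) | ∑ i : Fin 5, z (Fin.castSucc i) ^ 2 = 1} \ Set.range (F t)) z b) :=
  helper_nullSurvivorsDiePocket

/-- STUB 1'' · **MEAN CURVATURE FLOW WITH NECK SURGERY IN THE CYLINDER, UP TO NULL SURVIVORS** (lead reshape r17: THE RESEARCH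
STUB PROPER; size XL, HARDEST, the lead's).  For a homotopy 4-sphere `M` and a thin separating embedding `ι : M → N`, EITHER some
slice of `M` is resolved by a mean curvature flow with neck surgery in `N` (`CylNeckSurgeryResolvable`: leaves = discards `≅ S⁴`,
`S³ × S¹` and immortal thin END-SEPARATING flows) OR some compact connected `4`-manifold carries an immortal thin smooth cylinder flow
whose slices NEVER separate the ends and each have a POCKET — a point of `N ∖ F_t(P)` that cannot be joined inside `N ∖ F_t(P)` to the
lower end (a "null survivor" of the surgery tree: the capped-off null-homologous side `∂(pocket)` of a neck surgery; r19: BOTH defects are now pure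
path topology — no measure, no flux — and the zero vertical flux the GMT needs is DERIVED, `helper_fluxZeroOfPocket`).  This is exactly what the Chodosh–Mantoulidis–Schulze
genericity theorem (Thm. 1.13, `n = 4`, `Λ = 4/e⁻`, hypotheses ♦/♥ vacuous) and Daniels-Holgate surgery give when re-run in `N` with
Hamilton's monotonicity (landed) in place of Huisken's, plus the elementary bookkeeping (finitely many surgeries by the area quantum;
components of area `< μH⁴(S⁴)` are never immortal by the landed PARABOLIC AREA FLOOR `helper_volLeAreaAlongCylinderFlow`): after the
last stopping time every surviving component flows smoothly forever with `λ_cyl < 2`; the separating ones are `immortal` leaves, a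
non-separating one is the second disjunct.  See `Cruxes/CylinderRungTwo/PORT-LEDGER-c6.md` for the ingredient-by-ingredient status.
[size XL; research-level: the port of two printed Euclidean programmes to `N`]
[cite: ChodoshMantoulidisSchulze2025, Thm. 1.13, Cor. 1.19, Cor. 1.22] [cite: DanielsHolgate2022, Thm. 1.3, Thm. 1.4] -/
theorem stub_cylinderSurgeryFlowOrNull :
    ∀ (M : Type) [TopologicalSpace M] [T2Space M] [SecondCountableTopology M]
      [ChartedSpace (EuclideanSpace ℝ (Fin 4)) M] [IsManifold (𝓡 4) ∞ M],
      M ≃ₕ Metric.sphere (0 : EuclideanSpace ℝ (Fin 5)) 1 →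
      ∀ ι : M → EuclideanSpace ℝ (Fin 6), Manifold.IsSmoothEmbedding (𝓡 4) (𝓡 6) ∞ ι →
      (∀ x, ∑ i : Fin 5, ι x (Fin.castSucc i) ^ 2 = 1) → SeparatesEnds (Set.range ι) →
      cylEntropy (Set.range ι) < ENNReal.ofReal (4 / Real.exp 1) →
      (∃ κ : M → EuclideanSpace ℝ (Fin 6), CylNeckSurgeryResolvable M κ) ∨
        ∃ (P : Type) (_ : TopologicalSpace P) (_ : T2Space P) (_ : SecondCountableTopology P)
          (_ : ChartedSpace (EuclideanSpace ℝ (Fin 4)) P) (_ : IsManifold (𝓡 4) ∞ P) (_ : CompactSpace P)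
          (_ : ConnectedSpace P) (_ : MeasurableSpace P) (_ : BorelSpace P)
          (F : ℝ → P → EuclideanSpace ℝ (Fin 6)) (ν : ℝ → P → EuclideanSpace ℝ (Fin 6)) (T : ℝ),
          IsCylinderMCF P F ν T ∧ (∀ t, T ≤ t → cylEntropy (Set.range (F t)) < 2) ∧
            (∀ t, T ≤ t → ¬ SeparatesEnds (Set.range (F t))) ∧
            (∀ t, T ≤ t → ∃ (z : EuclideanSpace ℝ (Fin 6)) (R : ℝ), ∑ i : Fin 5, z (Fin.castSucc i) ^ 2 = 1 ∧
              z ∉ Set.range (F t) ∧ ∀ b : EuclideanSpace ℝ (Fin 6), ∑ i : Fin 5, b (Fin.castSucc i) ^ 2 = 1 → b 5 ≤ -R →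
                ¬ JoinedIn ({z : EuclideanSpace ℝ (Fin 6) | ∑ i : Fin 5, z (Fin.castSucc i) ^ 2 = 1} \ Set.range (F t)) z b) := by
  sorry

/-- STUB 1' · MEAN CURVATURE FLOW WITH NECK SURGERY IN THE CYLINDER (r15 registered stub; since r17 a DERIVED theorem: the weakened
research stub `stub_cylinderSurgeryFlowOrNull` with its null-survivor branch killed by `stub_nullSurvivorsDie`).  For a homotopy
4-sphere `M` and a thin separating embedding `ι : M → N`, some slice of `M` is resolved by a mean curvature flow with neck surgery in
`N` (`CylNeckSurgeryResolvable`).  Crux-EQUIVALENT modulo {ImmortalAreaToFloor, Cor. 1.5 (b), certificates} (tree: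
`helper_cylinderRungTwoOfSurgery` / `helper_cylinderSurgeryFlowOfCylinderRungTwo`).
[cite: ChodoshMantoulidisSchulze2025, Cor. 1.5 (b), Thm. 1.13, Cor. 1.19] [cite: DanielsHolgate2022, Thm. 1.3, §2.1 Def. 2.18–2.20, Thm. 2.29] -/
theorem stub_cylinderSurgeryFlow :
    ∀ (M : Type) [TopologicalSpace M] [T2Space M] [SecondCountableTopology M]
      [ChartedSpace (EuclideanSpace ℝ (Fin 4)) M] [IsManifold (𝓡 4) ∞ M],
      M ≃ₕ Metric.sphere (0 : EuclideanSpace ℝ (Fin 5)) 1 →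
      ∀ ι : M → EuclideanSpace ℝ (Fin 6), Manifold.IsSmoothEmbedding (𝓡 4) (𝓡 6) ∞ ι →
      (∀ x, ∑ i : Fin 5, ι x (Fin.castSucc i) ^ 2 = 1) → SeparatesEnds (Set.range ι) →
      cylEntropy (Set.range ι) < ENNReal.ofReal (4 / Real.exp 1) →
      ∃ κ : M → EuclideanSpace ℝ (Fin 6), CylNeckSurgeryResolvable M κ :=
  fun M _ _ _ _ _ e ι hι hN hsep hent =>
    (stub_cylinderSurgeryFlowOrNull M e ι hι hN hsep hent).resolve_right nullSurvivorsDie_pocket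

/-- STUB 6 · CHODOSH–MANTOULIDIS–SCHULZE 2025, Cor. 1.5 (b) for `n = 4`, simply connected case (lead reshape r15): the Literature
named fact `Literature.Geometry.Riemannian.ChodoshMantoulidisSchulze2025_cor15b_four` (`LowEntropyHypersurfacesFourAssembly.lean`;
statement only, D-0014): a simply connected closed connected embedded hypersurface of `ℝ⁵` with Colding–Minicozzi entropy
`≤ λ(S² × ℝ²) = 4/e` is diffeomorphic to `S⁴`.  It is the single input modulo which the route's crux `SliceIsolation`
(stmt-SmoothPoincare4-7632) is closed (`helper_sliceIsolationOfCor15b`, p132345), and here it recognises the IMMORTAL LEAVES of the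
surgery tree (`immortalLeafRecognition_of`).  The tree reduces it to its printed analytic input without Cerf's theorem
(`ChodoshMantoulidisSchulze2025_cor15b_four_of_neckSurgeryFlow`).  [size XL; published named fact]
[cite: ChodoshMantoulidisSchulze2025, Cor. 1.5 (b) and Cor. 1.22 (b) (n = 4)] [cite: DanielsHolgate2022, Thm. 1.3] -/
theorem stub_cor15bFour : Literature.Geometry.Riemannian.ChodoshMantoulidisSchulze2025_cor15b_four := by
  sorry

/-- STUB 6' · THE MID-SCALE KERNEL CERTIFICATES on `[10⁻², 10]` of crux 7632's line `conformal-kernel-domination` (its former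
registered stub `stub_certMid`, same signature): for every scale `T ∈ [1/100, 10]` a finite family of typed cylinder kernels of
total weight `≤ 1.47` dominates the pulled-back Euclidean Gaussian.  **LANDED, COMPUTATIONAL**: it is the tree's `certMid_all`
(`Theorems/CylinderEntropySliceIsolationOfCMS.lean`, assembled from the `native_decide` decade certificates `stub_certMidA/B/C`,
p131267 / p131268 / p130905), whose axiom closure contains `Lean.ofReduceBool`; it is therefore kept SORRIED in this skeleton
(standard axioms only) and discharged by the computational one-liner `Theorems/CylinderEntropyCylinderRungTwoCertMid.lean`
(`stub_certMid := certMid_all`, `--computational`), exactly as in crux 7632's skeleton. [folklore] -/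
theorem stub_certMid :
    ∀ T : ℝ, 1 / 100 ≤ T → T ≤ 10 →
      ∃ (n : ℕ) (σ τ w : Fin n → ℝ) (c : ℝ), (∀ j, 0 < τ j) ∧ (∀ j, 0 ≤ w j) ∧ 0 ≤ c ∧ (∑ j, w j) + c ≤ 147 / 100 ∧
        ∀ u s : ℝ, -1 ≤ s → s ≤ 1 →
          (8 * Real.pi ^ 2 / 3) * ((4 * Real.pi * T) ^ 2)⁻¹ * Real.exp (4 * u) *
              Real.exp (-(Real.exp (2 * u) - 2 * Real.exp u * s + 1) / (4 * T)) ≤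
            (∑ j, w j * (Literature.Geometry.Riemannian.SphericalCylinderEntropy.zonal (τ j) s *
              Real.exp (-(u - σ j) ^ 2 / (4 * τ j)))) + c := by
  sorry

/-- STUB 2 · THE FLUX IDENTITY — **LANDED** (wave 1, p92115, 8-file chain
`Theorems/CylinderEntropyCylinderRungTwoFluxIdentity*.lean`): connected compact cross-section, any
continuous unit normal field tangent to `N` ⇒ `|∫ ν₅ d(ι^*μH⁴)| = μH⁴(S⁴)` (Jacobian of the shadow
`= ν₅² ·` Gram, area formula, push-off, two sides, crossing count `d·(N₊−N₋) = 1` from separation). -/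
theorem stub_fluxIdentity :
    ∀ (M : Type) [TopologicalSpace M] [T2Space M] [SecondCountableTopology M]
      [ChartedSpace (EuclideanSpace ℝ (Fin 4)) M] [IsManifold (𝓡 4) ∞ M] [CompactSpace M]
      [ConnectedSpace M] [MeasurableSpace M] [BorelSpace M]
      (ι : M → EuclideanSpace ℝ (Fin 6)), Manifold.IsSmoothEmbedding (𝓡 4) (𝓡 6) ∞ ι →
      (∀ x, ∑ i : Fin 5, ι x (Fin.castSucc i) ^ 2 = 1) →
      (∃ R : ℝ, ∀ a b : EuclideanSpace ℝ (Fin 6), ∑ i : Fin 5, a (Fin.castSucc i) ^ 2 = 1 →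
        ∑ i : Fin 5, b (Fin.castSucc i) ^ 2 = 1 → a 5 ≤ -R → R ≤ b 5 →
        ¬ JoinedIn ({z : EuclideanSpace ℝ (Fin 6) | ∑ i : Fin 5, z (Fin.castSucc i) ^ 2 = 1} \
          Set.range ι) a b) →
      ∀ ν : M → EuclideanSpace ℝ (Fin 6), Continuous ν →
        (euclideanMetric (EuclideanSpace ℝ (Fin 6))).IsUnitNormal (𝓡 4) ι ν 1 →
        (∀ x, ∑ i : Fin 5, ν x (Fin.castSucc i) * ι x (Fin.castSucc i) = 0) →
        |∫ x, ν x 5 ∂(Measure.comap ι (μH[4] : Measure (EuclideanSpace ℝ (Fin 6))))| =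
          (μH[4] (Metric.sphere (0 : EuclideanSpace ℝ (Fin 5)) 1)).toReal :=
  Summit.SmoothPoincare4.SmoothPoincare4.Theorems.CylinderRungTwo.KillingFlux.stub_fluxIdentity

/-! STUB 3a `stub_hamiltonMonotonicity` — **LANDED** (waves 2–4: seven-file chain
`Theorems/CylinderEntropyCylinderRungTwoHamiltonMonotonicity{Transport,Frame,Divergence,KernelFlow,Density,Identity,}.lean`
over the Literature kernel theory `SphericalCylinderEntropy{SmallScales,Embedded,GegenbauerODE,HeatEquation,ZonalJets,
ZonalSmooth,KernelCalculus,MatrixHarnack}.lean` and `Lorentzian/HypersurfaceHessianCodimTwo.lean`), declared under THIS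
namespace by the landed file and imported above. -/

/-! STUBS 3b-i `stub_areaDissipation` and 3b-ii `stub_slabConfinement` — **LANDED** (wave 3: p96044 with
part 1 p95906 `Theorems/CylinderEntropyCylinderRungTwoAreaDissipation{Metric,}.lean`; p95829
`Theorems/CylinderEntropyCylinderRungTwoSlabConfinement.lean`), declared under THIS namespace by the landed
files and imported above, so the composition below uses the landed theorems by name (no local copy). -/

/-! STUB 3b'-i `stub_dissipationBudget` — **LANDED** (lead C reshape r7, p117610,
`Theorems/CylinderEntropyCylinderRungTwoDissipationBudget.lean`: `∫_T^t ∫ ‖∂_r F‖² dμ_r dr + μH⁴(M_t) ≤ μH⁴(M_T)`,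
transport formula + `‖∂_r F‖ = |H|` + fundamental theorem of calculus), declared under THIS namespace by the
landed file and imported above. -/

/-- **Area quantization** (lead C reshape r7: the FLOW-FREE GMT core of the immortal half).  Let `ι_k : M → N`
be smooth embedded cross-sections of a fixed compact connected `4`-manifold, separating the ends, with smooth unit
normals `ν_k` tangent to `N`, all of height `≤ B`, whose Willmore-type energies `∫ H_k² d(ι_k^*μH⁴)` tend to `0`
and whose areas `μH⁴(range ι_k)` tend to `A < ⊤`.  Then `A ∈ ℕ · μH⁴(S⁴)`.  WHY TRUE (lead C audit
`AUDIT-C-areaQuantization.md`, step by step): the `V_k = v(ι_k(M))` are integral `4`-varifolds of `ℝ⁶` supported in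
the compact `N ∩ {|z₅| ≤ B}`, of bounded mass and bounded first variation (`|H⃗^{ℝ⁶}| ≤ |H_k| + 4`), so by ALLARD'S
INTEGRAL COMPACTNESS THEOREM a subsequence converges to an INTEGRAL varifold `V` of mass `c₄ A` (no mass loss on a
compact set), stationary in `N` (`∫|H_k| → 0`); testing the first variation on `χ(z₅) z₅ e₅` gives `|P_S e₅|² = 0`
a.e. (horizontal tangent planes), on `φ(z₅) Ỹ`, `Y ∈ 𝔛(S⁴)`, gives `∫ div_{S⁴} Y dλ_t = 0` for the disintegration
`‖V‖ = ∫ λ_t dσ(t)`, so `λ_t` is a constant multiple of `vol_{S⁴}` (constancy), i.e. `‖V‖ = vol_{S⁴} ⊗ σ`; its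
`4`-density at `(z', t)` is `σ({t})/|S⁴|`-proportional for EVERY `z'`, and integrality (`Θ⁴ ∈ ℕ≥1` a.e.) makes
`σ` purely atomic with integer weights, finitely many: `A = m · μH⁴(S⁴)`.  The multiplicities `m = 2, 3, …` DO
occur for sequences satisfying every hypothesis (two slices; three near-slices joined by two tiny catenoidal
necks at alternating poles, closed as `S⁴`, with `∫ H² → 0` — dimension `4` is `H²`-subcritical), so the
statement is sharp; in the flow the entropy bound `< 2` then forces `m = 1` (`helper_areaToFloorOfQuantization`).
True and non-vacuous in Lean on the static slice (audit file).  BLOCKER: Allard, *On the first variation of a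
varifold*, Ann. of Math. 95 (1972), Thm. 6.4 (= Simon, GMT, Thm. 42.7/Rem. 42.8) — no varifold vocabulary in
tree or Mathlib. [size XL] [cite: Allard1972, Thm. 6.4] [cite: Simon1983, §41 (constancy), §42.7] -/
def AreaQuantization : Prop :=
  ∀ (M : Type) [TopologicalSpace M] [T2Space M] [SecondCountableTopology M]
    [ChartedSpace E4 M] [IsManifold (𝓡 4) ∞ M] [CompactSpace M] [ConnectedSpace M]
    [MeasurableSpace M] [BorelSpace M]
    (ι : ℕ → M → E6) (ν : ℕ → M → E6),
    (∀ k, Manifold.IsSmoothEmbedding (𝓡 4) (𝓡 6) ∞ (ι k)) →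
    (∀ k x, ∑ i : Fin 5, ι k x (Fin.castSucc i) ^ 2 = 1) →
    (∀ k, SeparatesEnds (Set.range (ι k))) →
    ∀ himm : ∀ k, (euclideanMetric E6).IsSpacelikeImmersion (𝓡 4) (ι k),
    (∀ k, (euclideanMetric E6).IsUnitNormal (𝓡 4) (ι k) (ν k) 1) →
    (∀ k x, ∑ i : Fin 5, ν k x (Fin.castSucc i) * ι k x (Fin.castSucc i) = 0) →
    (∀ k, ContMDiff (𝓡 4) (𝓡 6) ∞ (ν k)) →
    ∀ B : ℝ, (∀ k x, |ι k x 5| ≤ B) →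
    Filter.Tendsto (fun k => ∫⁻ x, ENNReal.ofReal
        ((euclideanMetric E6).meanCurvature (ι k) contMDiff_pullbackBilin_holds (himm k)
          (ν k) x ^ 2) ∂(Measure.comap (ι k) (μH[4] : Measure E6))) Filter.atTop (𝓝 0) →
    ∀ A : ℝ≥0∞, A < ⊤ →
    Filter.Tendsto (fun k => μH[4] (Set.range (ι k))) Filter.atTop (𝓝 A) →
    ∃ m : ℕ, A = m * μH[4] (Metric.sphere (0 : E5) 1)

/-- **Allard's integrality of limits** (varifold-free corollary of W. K. Allard, *On the first variation of a
varifold*, Ann. of Math. 95 (1972), Thm. 6.4 (compactness of integral varifolds with locally bounded first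
variation) with §3.5 / L. Simon, *Lectures on GMT* (1983), Thm. 42.7, Rem. 42.8 and §38 (rectifiable varifolds
have density equal to their multiplicity almost everywhere)), specialised to the cross-sections of this line (lead c2 reshape r10: THE
residual GMT debt of the immortal half, varifold-free).  Let `ι_k : M → N = S⁴ × ℝ ⊂ ℝ⁶` be smooth embeddings of a closed `4`-manifold with smooth unit
normals `ν_k` tangent to `N`, with areas `μH⁴(range ι_k) ≤ C` and total mean curvatures
`∫ |H_k| d(ι_k^* μH⁴) ≤ C` (so that the integral varifolds `v(ι_k(M))` of `ℝ⁶` have mass and first variation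
bounded by a constant: `|H⃗^{ℝ⁶}| ≤ |H_k| + 4` on `N`).  If the area measures `μH⁴⌊range ι_k` converge weakly
(against bounded continuous functions) to a finite measure `μ`, then for `μ`-a.e. `x` the `4`-density
`lim_{r↓0} μ(B(x,r)) / μH⁴(B⁴(0,r))` exists and is a POSITIVE INTEGER.  (By Allard's theorem a subsequence
of the `v(ι_k(M))` converges as varifolds to an INTEGRAL varifold `V`; its weight is the weak limit `μ`, and the
density of an integral varifold is its multiplicity, a positive integer, almost everywhere; both densities are
taken with the same Hausdorff normalisation, so no constant appears.)  WEAKER than the source (only the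
integrality of the limit density is kept; stationarity, rectifiability and varifold convergence are dropped).
-- TODO(general form): integral `m`-varifolds in an open subset of `ℝⁿ` with locally bounded first variation.
[cite: Allard1972, Thm. 6.4 and 3.5] [cite: Simon1983, Thm. 42.7, Rem. 42.8] -/
def AllardIntegralDensityOfLimits : Prop :=
  ∀ (M : Type) [TopologicalSpace M] [T2Space M] [SecondCountableTopology M]
    [ChartedSpace (EuclideanSpace ℝ (Fin 4)) M] [IsManifold (𝓡 4) ∞ M] [CompactSpace M]
    [MeasurableSpace M] [BorelSpace M]
    (ι : ℕ → M → EuclideanSpace ℝ (Fin 6)) (ν : ℕ → M → EuclideanSpace ℝ (Fin 6)),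
    (∀ k, Manifold.IsSmoothEmbedding (𝓡 4) (𝓡 6) ∞ (ι k)) →
    (∀ k x, ∑ i : Fin 5, ι k x (Fin.castSucc i) ^ 2 = 1) →
    ∀ himm : ∀ k, (euclideanMetric (EuclideanSpace ℝ (Fin 6))).IsSpacelikeImmersion (𝓡 4) (ι k),
    (∀ k, (euclideanMetric (EuclideanSpace ℝ (Fin 6))).IsUnitNormal (𝓡 4) (ι k) (ν k) 1) →
    (∀ k x, ∑ i : Fin 5, ν k x (Fin.castSucc i) * ι k x (Fin.castSucc i) = 0) →
    (∀ k, ContMDiff (𝓡 4) (𝓡 6) ∞ (ν k)) →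
    ∀ C : ℝ≥0∞, C < ⊤ → (∀ k, μH[4] (Set.range (ι k)) ≤ C) →
    (∀ k, ∫⁻ x, ENNReal.ofReal
        |(euclideanMetric (EuclideanSpace ℝ (Fin 6))).meanCurvature (ι k) contMDiff_pullbackBilin_holds (himm k)
          (ν k) x| ∂(Measure.comap (ι k) (μH[4] : Measure (EuclideanSpace ℝ (Fin 6)))) ≤ C) →
    ∀ (μ : Measure (EuclideanSpace ℝ (Fin 6))) [IsFiniteMeasure μ],
    (∀ g : BoundedContinuousFunction (EuclideanSpace ℝ (Fin 6)) ℝ,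
      Filter.Tendsto (fun k => ∫ z in Set.range (ι k), g z ∂(μH[4] : Measure (EuclideanSpace ℝ (Fin 6))))
        Filter.atTop (𝓝 (∫ z, g z ∂μ))) →
    ∀ᵐ x ∂μ, ∃ N : ℕ, 0 < N ∧
      Filter.Tendsto (fun r : ℝ => μ (Metric.ball x r) / μH[4] (Metric.ball (0 : EuclideanSpace ℝ (Fin 4)) r))
        (𝓝[>] 0) (𝓝 (N : ℝ≥0∞))

/-- (r10 registered form, DEMOTED at r15 to a hypothesis-style theorem) · Allard's integrality of limits spelled out over the
line's vocabulary is DEFINITIONALLY the Literature named fact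
`Literature.Geometry.GeometricMeasureTheory.Allard1972_integralDensityOfLimits_cylinderCrossSections` (ACCEPTED p126280, statement
only); since route-choice 2026-08-16 the line no longer carries it as a stub (its consumer is the route crux `AreaQuantization`,
stmt-SmoothPoincare4-17175, and the immortal half is taken through `stub_areaToFloor` = item 17197 instead).
[cite: Allard1972, Thm. 6.4 and 3.5] -/
theorem allardIntegralDensity_of_fact
    (hA : Literature.Geometry.GeometricMeasureTheory.Allard1972_integralDensityOfLimits_cylinderCrossSections) :
  ∀ (M : Type) [TopologicalSpace M] [T2Space M] [SecondCountableTopology M]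
    [ChartedSpace (EuclideanSpace ℝ (Fin 4)) M] [IsManifold (𝓡 4) ∞ M] [CompactSpace M]
    [MeasurableSpace M] [BorelSpace M]
    (ι : ℕ → M → EuclideanSpace ℝ (Fin 6)) (ν : ℕ → M → EuclideanSpace ℝ (Fin 6)),
    (∀ k, Manifold.IsSmoothEmbedding (𝓡 4) (𝓡 6) ∞ (ι k)) →
    (∀ k x, ∑ i : Fin 5, ι k x (Fin.castSucc i) ^ 2 = 1) →
    ∀ himm : ∀ k, (euclideanMetric (EuclideanSpace ℝ (Fin 6))).IsSpacelikeImmersion (𝓡 4) (ι k),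
    (∀ k, (euclideanMetric (EuclideanSpace ℝ (Fin 6))).IsUnitNormal (𝓡 4) (ι k) (ν k) 1) →
    (∀ k x, ∑ i : Fin 5, ν k x (Fin.castSucc i) * ι k x (Fin.castSucc i) = 0) →
    (∀ k, ContMDiff (𝓡 4) (𝓡 6) ∞ (ν k)) →
    ∀ C : ℝ≥0∞, C < ⊤ → (∀ k, μH[4] (Set.range (ι k)) ≤ C) →
    (∀ k, ∫⁻ x, ENNReal.ofReal
        |(euclideanMetric (EuclideanSpace ℝ (Fin 6))).meanCurvature (ι k) contMDiff_pullbackBilin_holds (himm k)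
          (ν k) x| ∂(Measure.comap (ι k) (μH[4] : Measure (EuclideanSpace ℝ (Fin 6)))) ≤ C) →
    ∀ (μ : Measure (EuclideanSpace ℝ (Fin 6))) [IsFiniteMeasure μ],
    (∀ g : BoundedContinuousFunction (EuclideanSpace ℝ (Fin 6)) ℝ,
      Filter.Tendsto (fun k => ∫ z in Set.range (ι k), g z ∂(μH[4] : Measure (EuclideanSpace ℝ (Fin 6))))
        Filter.atTop (𝓝 (∫ z, g z ∂μ))) →
    ∀ᵐ x ∂μ, ∃ N : ℕ, 0 < N ∧
      Filter.Tendsto (fun r : ℝ => μ (Metric.ball x r) / μH[4] (Metric.ball (0 : EuclideanSpace ℝ (Fin 4)) r))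
        (𝓝[>] 0) (𝓝 (N : ℝ≥0∞)) :=
  hA

/-- AREA QUANTIZATION (r7 registered stub, since route-choice 2026-08-16 the route crux `AreaQuantization` = stmt-SmoothPoincare4-17175,
`Iff.rfl`; DEMOTED at r15 to a hypothesis-style theorem from the Allard named fact): the landed assembly
`helper_areaQuantizationOfAllard` (`Theorems/CylinderEntropyCylinderRungTwoAreaQuantizationOfAllard.lean`) over the
eleven landed helpers S0 `helper_firstVariationBound` p125719, S1 `helper_limitMeasureExists` p125805 (Prokhorov), S2
`helper_productTestLimit` p125523 (+p125157), S3 `helper_heatSmoothing{ContDiff p124656, TimeDeriv p124236, LargeTime p124241,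
SmallTime p125890}` + `helper_zonalMassAndFirstMoment` p124265 (heat semigroup of `S⁴` from the typed zonal kernel), S4
`helper_equidistribution` p126142 (+p125973; constancy: `μ` uniform in the `S⁴` factor), S6 `helper_smallCapAsymptotics` p124572
(+ Literature p124419), S7 `helper_productIdentification` p124490 + `helper_densityOfProductMeasure` p125840, S8
`helper_atomicQuantization` p125745.  (Registered at r7 as a stub; kept under its registered name.)
[cite: Allard1972, Thm. 6.4 and 3.5] -/
theorem areaQuantization_of_allard
    (hA : Literature.Geometry.GeometricMeasureTheory.Allard1972_integralDensityOfLimits_cylinderCrossSections) :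
    ∀ (M : Type) [TopologicalSpace M] [T2Space M] [SecondCountableTopology M]
      [ChartedSpace (EuclideanSpace ℝ (Fin 4)) M] [IsManifold (𝓡 4) ∞ M] [CompactSpace M] [ConnectedSpace M]
      [MeasurableSpace M] [BorelSpace M]
      (ι : ℕ → M → EuclideanSpace ℝ (Fin 6)) (ν : ℕ → M → EuclideanSpace ℝ (Fin 6)),
      (∀ k, Manifold.IsSmoothEmbedding (𝓡 4) (𝓡 6) ∞ (ι k)) →
      (∀ k x, ∑ i : Fin 5, ι k x (Fin.castSucc i) ^ 2 = 1) →
      (∀ k, SeparatesEnds (Set.range (ι k))) →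
      ∀ himm : ∀ k, (euclideanMetric (EuclideanSpace ℝ (Fin 6))).IsSpacelikeImmersion (𝓡 4) (ι k),
      (∀ k, (euclideanMetric (EuclideanSpace ℝ (Fin 6))).IsUnitNormal (𝓡 4) (ι k) (ν k) 1) →
      (∀ k x, ∑ i : Fin 5, ν k x (Fin.castSucc i) * ι k x (Fin.castSucc i) = 0) →
      (∀ k, ContMDiff (𝓡 4) (𝓡 6) ∞ (ν k)) →
      ∀ B : ℝ, (∀ k x, |ι k x 5| ≤ B) →
      Filter.Tendsto (fun k => ∫⁻ x, ENNReal.ofReal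
          ((euclideanMetric (EuclideanSpace ℝ (Fin 6))).meanCurvature (ι k) contMDiff_pullbackBilin_holds (himm k)
            (ν k) x ^ 2) ∂(Measure.comap (ι k) (μH[4] : Measure (EuclideanSpace ℝ (Fin 6))))) Filter.atTop (𝓝 0) →
      ∀ A : ℝ≥0∞, A < ⊤ →
      Filter.Tendsto (fun k => μH[4] (Set.range (ι k))) Filter.atTop (𝓝 A) →
      ∃ m : ℕ, A = m * μH[4] (Metric.sphere (0 : EuclideanSpace ℝ (Fin 5)) 1) :=
  helper_areaQuantizationOfAllard (allardIntegralDensity_of_fact hA)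

/-- STUB 3b' · **AREA TO THE FLOOR ALONG IMMORTAL THIN CYLINDER FLOWS** — THE IMMORTAL HALF — **PROVED** (r21: it is the landed
`areaToFloor`, p144604, `Theorems/CylinderEntropyImmortalAreaToFloor.lean`, by the seat of item 17197 — Allard-free: Besicovitch good points, Euclidean
monotonicity with a height cut-off, the two-sheet Gaussian bound ⇒ no two good points on a vertical ⇒ injective shadow ⇒ area `≤ (1+ε) vol`; registered at r6;
from r7 to r14 a theorem modulo Allard; at r15 RE-REGISTERED AS THE SORRIED STUB OF THE IMMORTAL HALF, taken BY NAME from the route): this signature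
IS the route crux `ImmortalAreaToFloor` (stmt-SmoothPoincare4-17197) up to the landed folding
`Summit.SmoothPoincare4.SmoothPoincare4.Theorems.immortalAreaToFloor_of_stubShape` / `stubShape_of_immortalAreaToFloor` (p131170: the
eight flow hypotheses of the item are the fields of `IsCylinderMCF`; `SeparatesEnds`, `cylEntropy` unfold by `rfl`), so it closes the
moment 17197 does (`stubShape_of_immortalAreaToFloor ImmortalAreaToFloor_holds`).  Along an immortal smooth flow of compact connected
embedded cross-sections separating the ends with `λ_cyl < 2`, the area returns to the floor: `μH⁴(M_t) ≤ (1+ε) μH⁴(S⁴)` at some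
`t ≥ T`.  Landed towards it: Hamilton monotonicity, dissipation budget, heights converge, measure → `(A_∞/vol)·[slice]`, two-sided
densities at all scales (lead c4, r14); its own prover's Allard-free reduction to the static lemma "tilt-small thin cross-sections
have area near the floor" (`immortalAreaToFloor_of_areaNearFloorOfSmallTilt`, p132884) and the per-ball bricks
(`Theorems/CylinderEntropyImmortalAreaToFloor*.lean`).  The Allard route stays available hypothesis-style (`areaToFloor_of_allard`).
[size XL] [cite: Allard1972, Thm. 6.4] [cite: Brakke1978, §3] [cite: Hamilton1993, Thm. 4.1] -/
theorem stub_areaToFloor :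
    ∀ (M : Type) [TopologicalSpace M] [T2Space M] [SecondCountableTopology M]
      [ChartedSpace (EuclideanSpace ℝ (Fin 4)) M] [IsManifold (𝓡 4) ∞ M] [CompactSpace M]
      [ConnectedSpace M]
      (F : ℝ → M → EuclideanSpace ℝ (Fin 6)) (ν : ℝ → M → EuclideanSpace ℝ (Fin 6)) (T : ℝ),
      IsCylinderMCF M F ν T →
      (∀ t, T ≤ t → SeparatesEnds (Set.range (F t))) →
      (∀ t, T ≤ t → cylEntropy (Set.range (F t)) < 2) →
      ∀ ε : ℝ, 0 < ε → ∃ t : ℝ, T ≤ t ∧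
        μH[4] (Set.range (F t)) ≤
          ENNReal.ofReal (1 + ε) * μH[4] (Metric.sphere (0 : EuclideanSpace ℝ (Fin 5)) 1) :=
  areaToFloor

/-- The immortal half from Allard's integrality of limits (r7–r14 derivation, kept hypothesis-style): the landed glue
`helper_areaToFloorOfQuantization` (p117150) applied to the landed `stub_dissipationBudget` (p117610) and
`areaQuantization_of_allard`. [cite: Allard1972, Thm. 6.4] -/
theorem areaToFloor_of_allard
    (hA : Literature.Geometry.GeometricMeasureTheory.Allard1972_integralDensityOfLimits_cylinderCrossSections) : AreaToFloor :=
  helper_areaToFloorOfQuantization stub_dissipationBudget (areaQuantization_of_allard hA)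

/-- The registered stub IS the route crux `ImmortalAreaToFloor` (stmt-SmoothPoincare4-17197): its folded shape `AreaToFloor` follows
from the item's statement by the landed `stubShape_of_immortalAreaToFloor` (consistency check of "BY NAME"). [folklore] -/
example (h : (haveI : (Literature.Geometry.Riemannian.euclideanMetric (EuclideanSpace ℝ (Fin 6))).HasLeviCivita :=
      Literature.Geometry.Riemannian.instHasLeviCivitaEuclideanMetric;
    ∀ (M : Type) [TopologicalSpace M] [T2Space M] [SecondCountableTopology M] [ChartedSpace (EuclideanSpace ℝ (Fin 4)) M]
      [IsManifold (𝓡 4) ∞ M] [CompactSpace M] [ConnectedSpace M] (F : ℝ → M → EuclideanSpace ℝ (Fin 6))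
      (ν : ℝ → M → EuclideanSpace ℝ (Fin 6)) (T : ℝ),
      (∃ U : Set ℝ, IsOpen U ∧ Set.Ici T ⊆ U ∧
        ContMDiffOn (𝓘(ℝ, ℝ).prod (𝓡 4)) (𝓡 6) ∞ (fun q : ℝ × M => F q.1 q.2) (U ×ˢ Set.univ)) →
      (∀ t, T ≤ t → Manifold.IsSmoothEmbedding (𝓡 4) (𝓡 6) ∞ (F t)) →
      (∀ t, T ≤ t → ∀ x, ∑ i : Fin 5, F t x (Fin.castSucc i) ^ 2 = 1) →
      ∀ himm : (∀ t, T ≤ t → (Literature.Geometry.Riemannian.euclideanMetric (EuclideanSpace ℝ (Fin 6))).IsSpacelikeImmersion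
        (𝓡 4) (F t)),
      (∀ t, T ≤ t → (Literature.Geometry.Riemannian.euclideanMetric (EuclideanSpace ℝ (Fin 6))).IsUnitNormal (𝓡 4) (F t) (ν t) 1) →
      (∀ t, T ≤ t → ∀ x, ∑ i : Fin 5, ν t x (Fin.castSucc i) * F t x (Fin.castSucc i) = 0) →
      (∀ t, T ≤ t → ContMDiff (𝓡 4) (𝓡 6) ∞ (ν t)) →
      (∀ t (ht : T ≤ t) (x : M), mfderiv 𝓘(ℝ, ℝ) (𝓡 6) (fun s => F s x) t (1 : ℝ) =
        -((Literature.Geometry.Riemannian.euclideanMetric (EuclideanSpace ℝ (Fin 6))).meanCurvature (F t)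
          Literature.Geometry.Lorentzian.PseudoRiemannianMetric.contMDiff_pullbackBilin_holds (himm t ht) (ν t) x) • ν t x) →
      (∀ t, T ≤ t → SeparatesEnds (Set.range (F t))) →
      (∀ t, T ≤ t → cylEntropy (Set.range (F t)) < 2) →
      ∀ ε : ℝ, 0 < ε → ∃ t : ℝ, T ≤ t ∧ μH[4] (Set.range (F t)) ≤
        ENNReal.ofReal (1 + ε) * μH[4] (Metric.sphere (0 : EuclideanSpace ℝ (Fin 5)) 1))) : AreaToFloor :=
  Summit.SmoothPoincare4.SmoothPoincare4.Theorems.stubShape_of_immortalAreaToFloor h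

/-! STUB 3b'' `stub_relaxationOfAreaToFloor : HamiltonMonotonicity → AreaToFloor → Relaxation` — **LANDED**
(lead C reshape r6, p114786, `Theorems/CylinderEntropyCylinderRungTwoRelaxationOfAreaToFloor.lean`, with the soft
large-scale lemma `cylDensity_le_one_add_tail_mul`; converse `helper_areaToFloorOfRelaxation` p116890), declared under
THIS namespace by the landed file and imported above. -/

/-- **White's local regularity theorem for cylinder flows, single-sheet form** (lead c2 reshape r9: THE
analytic debt of path A, stated as a WEAKENING of B. White, *A local regularity theorem for mean curvature
flow*, Ann. of Math. 161 (2005) 1487–1519, Thm. 3.1 with §4).  There are `ε, C, c, c₁, d₀ > 0` depending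
only on the dimension `4` and the fixed ambient `N = S⁴ × ℝ ⊂ ℝ⁶` such that: for a smooth mean curvature
flow of closed embedded cross-sections of `N` (`IsCylinderMCF`), a scale `0 < d ≤ d₀` and a time `t` with
`T + d² ≤ t`, if the EUCLIDEAN Gaussian density ratios of the flow in `ℝ⁶`,
`Θ((y,s), r) = (4πr²)⁻² ∫_{M_{s-r²}} e^{-‖z-y‖²/4r²} dμHE⁴ = gaussianArea 4 y (r²) (range (F (s-r²)))`, are
`≤ 1 + ε` for every centre `y ∈ ℝ⁶`, every `s ≤ t + d²` and every radius with `t - d² ≤ s - r²` (all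
backward parabolic balls of the two-sided window `ℝ⁶ × [t-d², t+d²]` — MORE hypotheses than White's
`r < d(X, U)`), then at time `t`: (a') the unit normal `ν t` is `(C/d)`-Lipschitz for the chordal distance at
scale `c₁ d`, and (b') `c r⁴ ≤ μH⁴(M_t ∩ B(F t x, r))` for `0 < r ≤ c₁ d`.  This is White's
`K_{2,α}(𝓜; X) d(X, U) ≤ C` for `U = ℝ⁶ × (t-d², t+d²)`, `X = (F t x, t)`, `d(X,U) = d`, read through the
DEFINITION of the `K_{2,α}` norm (at scale `d/C` the flow near `X` is ONE graph with `|Du| ≤ 1`,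
`|D²u| ≤ C/d`; on one graph the normal `2`-plane field is Lipschitz, `n_N = (z', 0)` lies in it and `ν = ±J n_N`
with the sign fixed by continuity — whence (a'); the graph over the `r/2`-disc gives (b')), for the forced
flow in `ℝ⁶` (§4: `N ⊂ ℝ⁶` has `|II_N| ≤ 1`, force `-tr II_N ⊥ N` of norm `≤ 4`, absorbed in `d₀`).  The
density hypothesis is satisfiable as typed (static slice, `densityHypothesis_staticSlice` in the landed glue
file, via the PROVED small-scale Gaussian domination `gaussianArea ≤ (1+δ) λ_cyl`,
`Literature/Geometry/Riemannian/SphericalCylinderInclusionDomination.lean` p122897). [size XL; published]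
[cite: White2005, Thm. 3.1 and §4] -/
def WhiteRegularitySheet : Prop :=
  ∃ ε : ℝ, 0 < ε ∧ ∃ C : ℝ, 0 < C ∧ ∃ c : ℝ, 0 < c ∧ ∃ c₁ : ℝ, 0 < c₁ ∧ ∃ d₀ : ℝ, 0 < d₀ ∧
    ∀ (M : Type) [TopologicalSpace M] [T2Space M] [SecondCountableTopology M]
      [ChartedSpace E4 M] [IsManifold (𝓡 4) ∞ M] [CompactSpace M] [ConnectedSpace M]
      (F : ℝ → M → E6) (ν : ℝ → M → E6) (T : ℝ),
      IsCylinderMCF M F ν T → ∀ t d : ℝ, 0 < d → d ≤ d₀ → T + d ^ 2 ≤ t →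
      (∀ (y : E6) (s r : ℝ), 0 < r → t - d ^ 2 ≤ s - r ^ 2 → s ≤ t + d ^ 2 →
        gaussianArea 4 y (r ^ 2) (Set.range (F (s - r ^ 2))) ≤ ENNReal.ofReal (1 + ε)) →
      (∀ x y : M, ‖F t x - F t y‖ ≤ c₁ * d → ‖ν t x - ν t y‖ ≤ C / d * ‖F t x - F t y‖) ∧
      (∀ x : M, ∀ r : ℝ, 0 < r → r ≤ c₁ * d →
        ENNReal.ofReal (c * r ^ 4) ≤ μH[4] (Set.range (F t) ∩ Metric.ball (F t x) r))

/-- (r9 registered form, DEMOTED at r15 to a hypothesis-style theorem; path A only) · White's theorem over `IsCylinderMCF` from the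
Literature named fact `Literature.Geometry.Riemannian.White2005_localRegularity_cylinderFlowSheet` (ACCEPTED p126352, statement only)
through the landed glue `helper_whiteSheetOfFact` (p126341).  Since route-choice 2026-08-16 the recognition step of the line goes
through `SliceIsolation` / Cor. 1.5 (b) instead (path B, and the surgery path of r15), so White's theorem is no longer a stub.
[cite: White2005, Thm. 3.1 and §4] -/
theorem whiteRegularitySheet_of_fact (hW : Literature.Geometry.Riemannian.White2005_localRegularity_cylinderFlowSheet) :
    ∃ ε : ℝ, 0 < ε ∧ ∃ C : ℝ, 0 < C ∧ ∃ c : ℝ, 0 < c ∧ ∃ c₁ : ℝ, 0 < c₁ ∧ ∃ d₀ : ℝ, 0 < d₀ ∧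
      ∀ (M : Type) [TopologicalSpace M] [T2Space M] [SecondCountableTopology M]
        [ChartedSpace (EuclideanSpace ℝ (Fin 4)) M] [IsManifold (𝓡 4) ∞ M] [CompactSpace M] [ConnectedSpace M]
        (F : ℝ → M → EuclideanSpace ℝ (Fin 6)) (ν : ℝ → M → EuclideanSpace ℝ (Fin 6)) (T : ℝ),
        IsCylinderMCF M F ν T → ∀ t d : ℝ, 0 < d → d ≤ d₀ → T + d ^ 2 ≤ t →
        (∀ (y : EuclideanSpace ℝ (Fin 6)) (s r : ℝ), 0 < r → t - d ^ 2 ≤ s - r ^ 2 → s ≤ t + d ^ 2 →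
          gaussianArea 4 y (r ^ 2) (Set.range (F (s - r ^ 2))) ≤ ENNReal.ofReal (1 + ε)) →
        (∀ x y : M, ‖F t x - F t y‖ ≤ c₁ * d → ‖ν t x - ν t y‖ ≤ C / d * ‖F t x - F t y‖) ∧
        (∀ x : M, ∀ r : ℝ, 0 < r → r ≤ c₁ * d →
          ENNReal.ofReal (c * r ^ 4) ≤ μH[4] (Set.range (F t) ∩ Metric.ball (F t x) r)) :=
  helper_whiteSheetOfFact hW

/-- ε-REGULARITY FOR THIN CYLINDER FLOWS (r6 registered stub, DEMOTED at r15 to a hypothesis-style theorem from White's named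
fact; path A only): the landed glue `helper_epsilonRegularityOfWhite` (p123017,
`Theorems/CylinderEntropyCylinderRungTwoEpsilonRegularityOfWhite.lean`: thinness `λ_cyl < 1+ε` on `[t-1, t]`
propagates forward by Hamilton monotonicity, the PROVED small-scale Gaussian domination p122897 turns it into
White's Euclidean density hypothesis on a window of scale `d = min(d₀, r₁/2, 1)`, and (a'), (b') give (a), (b) with
`C := C/d`, `r₀ := c₁ d`, `|v₅| ≤ ‖v‖`) applied to `whiteRegularitySheet_of_fact`. [cite: White2005, Thm. 3.1 and §4] -/
theorem epsilonRegularity_of_white (hW : Literature.Geometry.Riemannian.White2005_localRegularity_cylinderFlowSheet) :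
    ∃ ε : ℝ, 0 < ε ∧ ∃ C : ℝ, 0 < C ∧ ∃ c : ℝ, 0 < c ∧ ∃ r₀ : ℝ, 0 < r₀ ∧
      ∀ (M : Type) [TopologicalSpace M] [T2Space M] [SecondCountableTopology M]
        [ChartedSpace (EuclideanSpace ℝ (Fin 4)) M] [IsManifold (𝓡 4) ∞ M] [CompactSpace M]
        [ConnectedSpace M]
        (F : ℝ → M → EuclideanSpace ℝ (Fin 6)) (ν : ℝ → M → EuclideanSpace ℝ (Fin 6)) (T : ℝ),
        IsCylinderMCF M F ν T →
        ∀ t : ℝ, T + 1 ≤ t →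
          (∀ s ∈ Set.Icc (t - 1) t, SeparatesEnds (Set.range (F s))) →
          (∀ s ∈ Set.Icc (t - 1) t, cylEntropy (Set.range (F s)) < ENNReal.ofReal (1 + ε)) →
          (∀ x y : M, ‖F t x - F t y‖ ≤ r₀ → |ν t x 5 - ν t y 5| ≤ C * ‖F t x - F t y‖) ∧
          (∀ x : M, ∀ r : ℝ, 0 < r → r ≤ r₀ →
            ENNReal.ofReal (c * r ^ 4) ≤
              μH[4] (Set.range (F t) ∩ Metric.ball (F t x) r)) :=
  helper_epsilonRegularityOfWhite (whiteRegularitySheet_of_fact hW)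

/-! STUB 4a-ii `stub_tiltGap : EpsilonRegularity → VerticalGap` — **LANDED** (lead C reshape r6/r7, p115218,
`Theorems/CylinderEntropyCylinderRungTwoTiltGap.lean`: the landed flux identity `|∫ ν₅| = vol S⁴` against the
entropy–area bound `μH⁴(M_t) ≤ (1+ε) μH⁴(S⁴)`; a zero of `ν₅` would cost `(1 - C r) c r⁴` of un-tilted area),
declared under THIS namespace by the landed file and imported above. -/

/-- STUB 4b · ONE SHEET — **LANDED** (wave 2, p93836, `Theorems/CylinderEntropyCylinderRungTwoOneSheet.lean`:
co-restricted shadow is a local diffeomorphism onto `S⁴`, hence a covering map from the compact `M`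
(Mathlib `isLocalHomeomorph_iff_isCoveringMap`), injective because `S⁴` is simply connected).
[cite: HirschDT1976, Ch. 1 §3 Thm. 3.1] -/
theorem stub_oneSheet :
    ∀ (M : Type) [TopologicalSpace M] [T2Space M] [SecondCountableTopology M]
      [ChartedSpace (EuclideanSpace ℝ (Fin 4)) M] [IsManifold (𝓡 4) ∞ M] [CompactSpace M]
      [ConnectedSpace M] (ι : M → EuclideanSpace ℝ (Fin 6)),
      Manifold.IsSmoothEmbedding (𝓡 4) (𝓡 6) ∞ ι →
      (∀ x, ∑ i : Fin 5, ι x (Fin.castSucc i) ^ 2 = 1) →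
      (∀ x : M, Function.Injective
        (mfderiv (𝓡 4) (𝓡 5) ((truncL : EuclideanSpace ℝ (Fin 6) → EuclideanSpace ℝ (Fin 5)) ∘ ι) x)) →
      Function.Injective ((truncL : EuclideanSpace ℝ (Fin 6) → EuclideanSpace ℝ (Fin 5)) ∘ ι) :=
  Summit.SmoothPoincare4.SmoothPoincare4.Theorems.CylinderRungTwo.KillingFlux.stub_oneSheet

/-- STUB 5 · a compact connected cross-section whose shadow is an injective immersion is `≃ₘ S⁴` —
**LANDED** (wave 1, p74738, `Theorems/CylinderEntropyCylinderRungTwoGraphicalIsSphere.lean`: inverse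
function theorem + clopen range in the connected `S⁴` + `IsLocalDiffeomorph.diffeomorphOfBijective`).
[cite: HirschDT1976, Ch. 1 §3 Thm. 3.1] -/
theorem stub_graphicalIsSphere :
    ∀ (M : Type) [TopologicalSpace M] [T2Space M] [SecondCountableTopology M]
      [ChartedSpace (EuclideanSpace ℝ (Fin 4)) M] [IsManifold (𝓡 4) ∞ M] [CompactSpace M]
      [ConnectedSpace M] (ι : M → EuclideanSpace ℝ (Fin 6)),
      Manifold.IsSmoothEmbedding (𝓡 4) (𝓡 6) ∞ ι →
      (∀ x, ∑ i : Fin 5, ι x (Fin.castSucc i) ^ 2 = 1) →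
      (Function.Injective ((truncL : EuclideanSpace ℝ (Fin 6) → EuclideanSpace ℝ (Fin 5)) ∘ ι) ∧
        ∀ x : M, Function.Injective
          (mfderiv (𝓡 4) (𝓡 5) ((truncL : EuclideanSpace ℝ (Fin 6) → EuclideanSpace ℝ (Fin 5)) ∘ ι) x)) →
      Nonempty (M ≃ₘ⟮𝓡 4, 𝓡 4⟯ Metric.sphere (0 : EuclideanSpace ℝ (Fin 5)) 1) :=
  Summit.SmoothPoincare4.SmoothPoincare4.Theorems.CylinderRungTwo.KillingFlux.stub_graphicalIsSphere

/-! ## Glue for the reshaped stubs (sorry-free; from the wave-1 workers' files) -/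

/-- **`Relaxation` from Hamilton monotonicity and large-scale relaxation** (pure bookkeeping in `ℝ≥0∞`,
worker of `stub_relaxation`): given `ε`, take `t₀` for `ε/2` at scales `≥ 1`; for `s ≥ t₀ + 1` every
density `F̂_{p,τ}(M_s)`, `τ > 0`, is `≤ F̂_{p,τ+1}(M_{s-1}) ≤ 1 + ε/2 < 1 + ε` (monotonicity with lag
`σ = 1` moves every scale to `τ + 1 ≥ 1`). [folklore] -/
theorem relaxation_of (hmono : HamiltonMonotonicity) (hlarge : LargeScaleRelaxation) : Relaxation := by
  intro M _ _ _ _ _ _ _ F ν T hflow hsep hent ε hε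
  obtain ⟨t₀, hTt₀, hL⟩ := hlarge M F ν T hflow hsep hent (ε / 2) (half_pos hε)
  refine ⟨t₀ + 1, by linarith, fun s hs => ?_⟩
  have hle : cylEntropy (Set.range (F s)) ≤ ENNReal.ofReal (1 + ε / 2) := by
    simp only [cylEntropy]
    refine iSup₂_le fun p hp => iSup₂_le fun τ hτ => ?_
    have h1 : T ≤ s - 1 := by linarith
    calc cylDensity (Set.range (F s)) p τ
        ≤ cylDensity (Set.range (F (s - 1))) p (τ + 1) := by
          simpa only [sub_add_cancel] using hmono M F ν T hflow p hp (s - 1) 1 τ h1 zero_le_one hτ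
      _ ≤ ENNReal.ofReal (1 + ε / 2) := hL (s - 1) (by linarith) p hp (τ + 1) (by linarith)
  refine lt_of_le_of_lt hle ?_
  rw [ENNReal.ofReal_lt_ofReal_iff (by linarith)]
  linarith

/-- A vector of `ℝ⁶` with vanishing truncation and orthogonal to a vector with non-zero last coordinate
vanishes (worker of `stub_epsilonGraphical`). [folklore] -/
theorem eq_zero_of_truncL_eq_zero_of_inner_eq_zero {n w : E6} (hw : truncL w = 0)
    (hinner : ⟪n, w⟫ = 0) (h5 : n 5 ≠ 0) : w = 0 := by
  have hc : ∀ i : Fin 5, w (Fin.castSucc i) = 0 := fun i => by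
    have := congrArg (fun z : E5 => z i) hw
    simpa using this
  have hsum : ⟪n, w⟫ = ∑ j : Fin 6, w j * n j := by
    rw [PiLp.inner_apply]
    simp [mul_comm]
  rw [hsum, Fin.sum_univ_castSucc] at hinner
  simp only [hc, zero_mul, Finset.sum_const_zero, zero_add] at hinner
  have h5w : w (Fin.last 5) = 0 := (mul_eq_zero.1 hinner).resolve_right h5
  ext j
  obtain ⟨i, rfl⟩ | rfl := Fin.eq_castSucc_or_eq_last j
  · simpa using hc i
  · simpa using h5w

/-- **The shadow of a cross-section is immersive where the normal is not horizontal** (worker of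
`stub_epsilonGraphical`): if `dι_x` is injective, `ν x ⊥ dι_x(T_x M)` and `ν x 5 ≠ 0`, then
`d(truncL ∘ ι)_x = truncL ∘ dι_x` is injective (its kernel is `dι_x⁻¹(ℝ e₅)`, and `e₅ ⊥̸ ν x`). [folklore] -/
theorem injective_mfderiv_truncL_comp {M : Type} [TopologicalSpace M] [ChartedSpace E4 M]
    {ι ν : M → E6} {x : M} (hι : MDifferentiableAt (𝓡 4) (𝓡 6) ι x)
    (hinj : Function.Injective (mfderiv (𝓡 4) (𝓡 6) ι x))
    (hν : (euclideanMetric E6).IsNormalTo (𝓡 4) ι ν) (h5 : ν x 5 ≠ 0) :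
    Function.Injective (mfderiv (𝓡 4) (𝓡 5) ((truncL : E6 → E5) ∘ ι) x) := by
  have hcomp : mfderiv (𝓡 4) (𝓡 5) ((truncL : E6 → E5) ∘ ι) x =
      (truncL : E6 →L[ℝ] E5).comp (mfderiv (𝓡 4) (𝓡 6) ι x) :=
    ((truncL.hasMFDerivAt (x := ι x)).comp x hι.hasMFDerivAt).mfderiv
  rw [hcomp]
  refine (injective_iff_map_eq_zero _).2 fun v hv => ?_
  have hw : (mfderiv (𝓡 4) (𝓡 6) ι x v : E6) = 0 := by
    refine eq_zero_of_truncL_eq_zero_of_inner_eq_zero (n := ν x) hv ?_ h5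
    have h := hν x v
    rwa [euclideanMetric_apply] at h
  exact hinj (by rw [hw, map_zero])

/-- **`EpsilonGraphical` from the vertical gap and one-sheetedness** (worker of `stub_epsilonGraphical`):
`VerticalGap` gives `ν t x 5 ≠ 0`, `injective_mfderiv_truncL_comp` turns it into the immersion clause
of `IsGraphical`, and `OneSheet` gives injectivity; the FLUX IDENTITY (STUB 2) stays the hypothesis of
the registered implication (it is one of the two classical routes to `OneSheet`). [folklore] -/
theorem epsilonGraphical_of (h₁ : VerticalGap) (h₂ : OneSheet) : FluxIdentity → EpsilonGraphical := by
  intro _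
  obtain ⟨ε, hε, hgap⟩ := h₁
  refine ⟨ε, hε, ?_⟩
  intro M _ _ _ _ _ _ _ F ν T hflow t ht hsep hent
  have hTt : T ≤ t := by linarith
  have himm : ∀ x : M, Function.Injective (mfderiv (𝓡 4) (𝓡 5) ((truncL : E6 → E5) ∘ F t) x) := by
    intro x
    have hsm : ContMDiff (𝓡 4) (𝓡 6) ∞ (F t) := (hflow.isSmoothEmbedding t hTt).contMDiff
    exact injective_mfderiv_truncL_comp ((hsm x).mdifferentiableAt (by simp))
      ((hflow.isSpacelikeImmersion t hTt).injective_mfderiv x) (hflow.isUnitNormal t hTt).1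
      (hgap M F ν T hflow t ht hsep hent x)
  exact ⟨h₂ M (F t) (hflow.isSmoothEmbedding t hTt) (hflow.mem_cyl t hTt) himm, himm⟩

/-! ## The lead's stub: `FiniteTimeHalf` is implied by the crux (static slice transport) -/

section LeadStub

open Literature.Geometry.Manifold.CylinderSlice

set_option hygiene false in
local notation "S4" => Metric.sphere (0 : EuclideanSpace ℝ (Fin 5)) 1

/-- Chain rule for the transported slice embedding: `d(sliceMap c ∘ d)_y = d(sliceMap c)_{d y} ∘ dd_y`.
[folklore] -/
theorem mfderiv_sliceMap_comp (c : ℝ) {M : Type} [TopologicalSpace M] [ChartedSpace E4 M]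
    [IsManifold (𝓡 4) ∞ M] (d : M ≃ₘ⟮𝓡 4, 𝓡 4⟯ S4) (y : M) :
    mfderiv (𝓡 4) (𝓡 6) (sliceMap c ∘ d) y =
      (mfderiv (𝓡 4) (𝓡 6) (sliceMap c) (d y)).comp (mfderiv (𝓡 4) (𝓡 4) d y) := by
  haveI : Fact (Module.finrank ℝ E5 = 4 + 1) := ⟨finrank_euclideanSpace_fin⟩
  have h1 : MDifferentiableAt (𝓡 4) (𝓡 6) (sliceMap c) (d y) :=
    ((contMDiff_sliceMap c (m := ∞)) (d y)).mdifferentiableAt (by simp)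
  have h2 : MDifferentiableAt (𝓡 4) (𝓡 4) d y := (d.contMDiff y).mdifferentiableAt (by simp)
  exact mfderiv_comp y h1 h2

/-- The differential of a diffeomorphism kills no non-zero vector. [folklore] -/
theorem mfderiv_diffeomorph_ne_zero {M : Type} [TopologicalSpace M] [ChartedSpace E4 M]
    [IsManifold (𝓡 4) ∞ M] (d : M ≃ₘ⟮𝓡 4, 𝓡 4⟯ S4) (y : M) {v : TangentSpace (𝓡 4) y}
    (hv : v ≠ 0) : mfderiv (𝓡 4) (𝓡 4) d y v ≠ 0 := by
  haveI : Fact (Module.finrank ℝ E5 = 4 + 1) := ⟨finrank_euclideanSpace_fin⟩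
  intro h
  have hinj : Function.Injective (d.mfderivToContinuousLinearEquiv (by simp) y) :=
    (d.mfderivToContinuousLinearEquiv (by simp) y).injective
  have h' : ((d.mfderivToContinuousLinearEquiv (by simp) y :
      TangentSpace (𝓡 4) y →L[ℝ] TangentSpace (𝓡 4) (d y))) v = 0 := by
    rw [Diffeomorph.mfderivToContinuousLinearEquiv_coe]; exact h
  refine hv (hinj ?_)
  rw [map_zero]
  exact h'

/-- The transported slice embedding `sliceMap c ∘ d` is a (spacelike =) immersion for the Euclidean
metric. [folklore] -/
theorem isSpacelikeImmersion_sliceMap_comp (c : ℝ) {M : Type} [TopologicalSpace M] [ChartedSpace E4 M]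
    [IsManifold (𝓡 4) ∞ M] (d : M ≃ₘ⟮𝓡 4, 𝓡 4⟯ S4) :
    (euclideanMetric E6).IsSpacelikeImmersion (𝓡 4) (sliceMap c ∘ d) := by
  haveI : Fact (Module.finrank ℝ E5 = 4 + 1) := ⟨finrank_euclideanSpace_fin⟩
  refine ⟨(contMDiff_sliceMap c).comp d.contMDiff, fun y v hv => ?_⟩
  have hne := mfderiv_diffeomorph_ne_zero d y hv
  have hpos := (isSpacelikeImmersion_sliceMap c).inducedBilin_pos (d y) hne
  rw [inducedBilin_apply] at hpos ⊢
  rw [mfderiv_sliceMap_comp]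
  exact hpos

/-- **Transported slices are minimal**: the mean curvature of `sliceMap c ∘ d` with respect to `e₅`
vanishes for every diffeomorphism `d : M ≃ₘ S⁴` (same level-set argument as `meanCurvature_sliceMap`:
the image lies in a level set of the LINEAR height, whose Hessian is zero). [folklore] -/
theorem meanCurvature_sliceMap_comp (c : ℝ) {M : Type} [TopologicalSpace M] [ChartedSpace E4 M]
    [IsManifold (𝓡 4) ∞ M] (d : M ≃ₘ⟮𝓡 4, 𝓡 4⟯ S4)
    (hf : (euclideanMetric E6).IsSpacelikeImmersion (𝓡 4) (sliceMap c ∘ d)) (y : M) :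
    (euclideanMetric E6).meanCurvature (sliceMap c ∘ d) contMDiff_pullbackBilin_holds hf
      (fun _ => axis) y = 0 := by
  haveI : Fact (Module.finrank ℝ E5 = 4 + 1) := ⟨finrank_euclideanSpace_fin⟩
  have hFl : ContDiff ℝ ∞ (heightL : E6 → ℝ) := heightL.contDiff
  have hy : (𝓡 4).IsInteriorPoint y := BoundarylessManifold.isInteriorPoint
  have hx : ∇ (heightL : E6 → ℝ) ((sliceMap c ∘ d) y) ≠ 0 := by
    rw [gradient_heightL]
    simp [axis]
  have hdF : ∀ w : TangentSpace (𝓡 4) y,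
      fderiv ℝ (heightL : E6 → ℝ) ((sliceMap c ∘ d) y)
        (mfderiv (𝓡 4) 𝓘(ℝ, E6) (sliceMap c ∘ d) y w) = 0 := by
    intro w
    rw [ContinuousLinearMap.fderiv]
    have h : mfderiv (𝓡 4) 𝓘(ℝ, E6) (sliceMap c ∘ d) y w =
        mfderiv (𝓡 4) (𝓡 6) (sliceMap c) (d y) (mfderiv (𝓡 4) (𝓡 4) d y w) := by
      have := mfderiv_sliceMap_comp c d y
      exact DFunLike.congr_fun this w
    rw [h]
    exact heightL_mvfderiv_sliceMap c (d y) _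
  have hν : (fun z : M => (unitGradient (heightL : E6 → ℝ) ((sliceMap c ∘ d) z) : E6)) =
      fun _ => axis := by
    funext z
    exact unitGradient_heightL _
  obtain ⟨b, -, -, hH⟩ := meanCurvature_unitGradient_eq_sum (W := E6) (I' := 𝓡 4) hFl
    contMDiff_pullbackBilin_holds hf hy hx hdF (finrank_euclideanSpace_fin (𝕜 := ℝ) (n := 4))
  rw [hν] at hH
  rw [hH]
  have hfd : fderiv ℝ (heightL : E6 → ℝ) = fun _ => heightL := by
    funext z
    exact ContinuousLinearMap.fderiv heightL
  refine mul_eq_zero_of_right _ (Finset.sum_eq_zero fun i _ => ?_)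
  rw [iteratedFDeriv_two_apply, hfd, fderiv_fun_const]
  rfl

/-- **The static slice flow transported along a diffeomorphism `d : M ≃ₘ S⁴` is a cylinder flow of
`M`** (every clause of `IsCylinderMCF`, as for `isCylinderMCF_staticSlice`). [folklore] -/
theorem isCylinderMCF_staticSlice_comp (c T : ℝ) {M : Type} [TopologicalSpace M] [ChartedSpace E4 M]
    [IsManifold (𝓡 4) ∞ M] (d : M ≃ₘ⟮𝓡 4, 𝓡 4⟯ S4) :
    IsCylinderMCF M (fun _ => sliceMap c ∘ d) (fun _ _ => axis) T where
  contMDiffOn := by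
    haveI : Fact (Module.finrank ℝ E5 = 4 + 1) := ⟨finrank_euclideanSpace_fin⟩
    exact ⟨Set.univ, isOpen_univ, Set.subset_univ _,
      (((contMDiff_sliceMap c).comp d.contMDiff).comp contMDiff_snd).contMDiffOn⟩
  isSmoothEmbedding _ _ := by
    haveI : Fact (Module.finrank ℝ E5 = 4 + 1) := ⟨finrank_euclideanSpace_fin⟩
    exact (isSmoothEmbedding_sliceMap c).comp_diffeomorph d
  mem_cyl _ _ x := sum_sq_sliceMap c (d x)
  isSpacelikeImmersion _ _ := isSpacelikeImmersion_sliceMap_comp c d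
  isUnitNormal _ _ := by
    haveI : Fact (Module.finrank ℝ E5 = 4 + 1) := ⟨finrank_euclideanSpace_fin⟩
    refine ⟨fun y v => ?_, fun y => ?_⟩
    · rw [euclideanMetric_apply]
      have h : mfderiv (𝓡 4) 𝓘(ℝ, E6) (sliceMap c ∘ d) y v =
          mfderiv (𝓡 4) (𝓡 6) (sliceMap c) (d y) (mfderiv (𝓡 4) (𝓡 4) d y v) :=
        DFunLike.congr_fun (mfderiv_sliceMap_comp c d y) v
      change heightL (mfderiv (𝓡 4) 𝓘(ℝ, E6) (sliceMap c ∘ d) y v) = 0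
      rw [h]
      exact heightL_mvfderiv_sliceMap c (d y) _
    · rw [euclideanMetric_apply]
      change ⟪axis, axis⟫ = (1 : ℝ)
      simp [axis]
  normal_tangent _ _ x := by simp [axis, castSucc_ne_five]
  contMDiff_normal _ _ := contMDiff_const
  velocity_eq t _ x := by
    rw [meanCurvature_sliceMap_comp, neg_zero, zero_smul]
    show mfderiv 𝓘(ℝ, ℝ) (𝓡 6) (fun _ : ℝ => (sliceMap c ∘ d) x) t 1 = 0
    rw [mfderiv_const]
    rfl

/-- The height of a transported slice is the constant `c`. [folklore] -/
theorem sliceMap_comp_apply_five (c : ℝ) {M : Type} (d : M → S4) (x : M) :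
    (sliceMap c ∘ d) x 5 = c := by
  show sliceMap c (d x) 5 = c
  rw [sliceMap_eq_comp]
  show (padL ((d x : S4) : E5) + c • axis) 5 = c
  simp [padL_apply_last, axis]

/-- **The crux implies the lead's stub** (one half of "`stub_finiteTimeHalf` is crux-equivalent"): if
`CylinderRungTwo` holds and slices are thin (`λ_cyl(S⁴ × {c}) < 4/e`, i.e. the `≤ 1` half of the
support item `SliceCalibration`, stmt-SmoothPoincare4-7634, transported to every height), then every
thin homotopy-sphere cross-section `ι : M → N` carries an immortal smooth thin cylinder flow OF `M` in
its slab — namely the STATIC slice at the height of any point of `ι(M)`, transported along the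
diffeomorphism `M ≃ₘ S⁴` that the crux provides.  Together with the composition below
(`cylinderRungTwo_of_parts` / `CylinderRungTwo_of`: `FiniteTimeHalf` + stubs 2–5 ⇒ crux) this shows that, modulo the true
analytic stubs 3a–4b and slice thinness, `stub_finiteTimeHalf` is EQUIVALENT to the crux — it is the
crux-sized stub of this line (standing disprover's sandwich `cylinderRungTwo_iff_spc4_of_thin`). -/
theorem finiteTimeHalf_of_cylinderRungTwo (hR : CylinderRungTwo)
    (hslice : ∀ c : ℝ, cylEntropy (Set.range (sliceMap c)) < ENNReal.ofReal (4 / Real.exp 1)) :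
    FiniteTimeHalf := by
  haveI : Fact (Module.finrank ℝ E5 = 4 + 1) := ⟨finrank_euclideanSpace_fin⟩
  intro M _ _ _ _ _ e ι hι hN hsep hent
  obtain ⟨d⟩ := hR M e ι hι hN hsep hent
  -- `M` is non-empty (it is homotopy equivalent to the non-empty `S⁴`)
  have y₀ : M := e.invFun ⟨EuclideanSpace.single 0 1, by simp⟩
  set c : ℝ := ι y₀ 5 with hc
  have hrange : Set.range (sliceMap c ∘ d) = Set.range (sliceMap c) := by
    rw [Set.range_comp, EquivLike.range_eq_univ d, Set.image_univ]
  refine ⟨fun _ => sliceMap c ∘ d, fun _ _ => axis, 0, isCylinderMCF_staticSlice_comp c 0 d,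
    fun t _ => ?_, fun t _ => ?_, fun t _ x => ⟨y₀, y₀, ?_, ?_⟩⟩
  · show SeparatesEnds (Set.range (sliceMap c ∘ d))
    rw [hrange]
    exact separatesEnds_of_slice_subset (by rw [range_sliceMap])
  · show cylEntropy (Set.range (sliceMap c ∘ d)) < ENNReal.ofReal (4 / Real.exp 1)
    rw [hrange]
    exact hslice c
  · show ι y₀ 5 - 1 ≤ (sliceMap c ∘ d) x 5
    rw [sliceMap_comp_apply_five]; linarith
  · show (sliceMap c ∘ d) x 5 ≤ ι y₀ 5 + 1
    rw [sliceMap_comp_apply_five]; linarith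

end LeadStub

/-! ## Relaxation up to multiplicity (lead c4, r14; sorry-free, LANDED — importable, not re-exported here)

The Allard-free structure of the immortal half lives in the landed helper files (import them directly;
they are kept out of this skeleton's import closure only so that the skeleton elaborates on every farm
node while the newest modules build):

* `helper_heightsConverge` (`…Theorems/CylinderEntropyCylinderRungTwoHeightsConverge.lean`, p134255):
  for `IsCylinderMCF M F ν T` with `λ_cyl(M_t) < 2` there is `c` with `sup_x |(F s x)₅ - c| → 0`;
* `helper_measureConvergesToSlice` (`…MeasureConvergesToSlice.lean`, p134148): the area measures
  `μH⁴⌊M_s` converge to `(A_∞/vol)·[S⁴ × {c}]` against `C¹` test functions bounded on `N`,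
  `A_∞ = ⨅_{t ≥ T} μH⁴(M_t)`;
* `helper_upperDensityAllScales` (`…UpperDensityAllScales.lean`, p133536): for separating flows,
  `F̂_{p,τ}(M_s) ≤ (1+ε) A_∞/vol` for every centre `p ∈ N`, every scale `τ > 0`, `s ≥ s₀(ε)`;
  with `helper_unitLowerDensityAlongFlow` (p129125) this is two-sided density control at all scales;
* the static Gaussian monotonicity `helper_staticTwoScaleMonotonicity` / `helper_localAreaBound`
  (`…StaticMonotonicity.lean`, p131292; imported above).

What `stub_areaToFloor` still needs beyond these is exactly UNIT MULTIPLICITY `A_∞ = vol(S⁴)`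
(`Cruxes/CylinderRungTwo/INTEGRALITY-MEMO-c4.md`, (UM)). -/

/-! ## The surgery path (lead reshape r15; sorry-free): immortal-leaf recognition + the topology of the surgery tree -/

section SurgeryPath

open Literature.Topology.FourManifolds
open Summit.SmoothPoincare4.SmoothPoincare4.Theorems.CylinderEntropySliceIsolation
  (stub_dominationBookkeeping stub_conformalEmbedding reductionCertificates_certAll reductionCertificates_sphereEntropy_le)

set_option hygiene false in
local notation "S4" => Metric.sphere (0 : EuclideanSpace ℝ (Fin 5)) 1

attribute [local instance] fact_finrank_euclideanSpace_succ

/-- Statement of `stub_cylinderSurgeryFlow` (readable name). [cite: DanielsHolgate2022, Thm. 1.3] -/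
def CylinderSurgeryFlow : Prop :=
  ∀ (M : Type) [TopologicalSpace M] [T2Space M] [SecondCountableTopology M]
    [ChartedSpace E4 M] [IsManifold (𝓡 4) ∞ M],
    M ≃ₕ Metric.sphere (0 : E5) 1 →
    ∀ ι : M → E6, Manifold.IsSmoothEmbedding (𝓡 4) (𝓡 6) ∞ ι →
    (∀ x, ∑ i : Fin 5, ι x (Fin.castSucc i) ^ 2 = 1) → SeparatesEnds (Set.range ι) →
    cylEntropy (Set.range ι) < ENNReal.ofReal (4 / Real.exp 1) →
    ∃ κ : M → E6, CylNeckSurgeryResolvable M κ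

/-- **Recognition of immortal leaves** (the interface between the surgery tree and the immortal half): a compact connected SIMPLY
CONNECTED `4`-manifold carrying an immortal smooth flow of embedded cross-sections of `N`, every slice separating the ends with
`λ_cyl < 2`, is diffeomorphic to `S⁴`. [folklore] -/
def ImmortalLeafRecognition : Prop :=
  ∀ (P : Type) [TopologicalSpace P] [T2Space P] [SecondCountableTopology P]
    [ChartedSpace E4 P] [IsManifold (𝓡 4) ∞ P] [CompactSpace P] [ConnectedSpace P],
    SimplyConnectedSpace P →
    ∀ (F : ℝ → P → E6) (ν : ℝ → P → E6) (T : ℝ), IsCylinderMCF P F ν T →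
    (∀ t, T ≤ t → SeparatesEnds (Set.range (F t))) →
    (∀ t, T ≤ t → cylEntropy (Set.range (F t)) < 2) →
    Nonempty (P ≃ₘ⟮𝓡 4, 𝓡 4⟯ Metric.sphere (0 : E5) 1)

/-- **Recognition of nearly calibrated SIMPLY CONNECTED cross-sections from Cor. 1.5 (b)** (the proof of crux 7632's
`sliceIsolation_of_cor15b_of_certificates`, re-run with `SimplyConnectedSpace P` in place of `P ≃ₕ S⁴`, which there served only
to produce compactness, connectedness and simple connectivity): with `ε₀ := 4/(1.47 e) - 1 > 0`, every compact connected simply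
connected cross-section `ι : P → N` with `λ_cyl(range ι) < 1 + ε₀` is `≅ S⁴` — the conformal image `Φ(range ι) ⊂ ℝ⁵`,
`Φ(z) = e^{z₅} z'`, has Gaussian entropy `≤ 1.47 · λ_cyl < 4/e = λ(S² × ℝ²)` (landed all-scales domination
`stub_dominationBookkeeping` with the mid-scale kernel certificates `hmid`), `Φ ∘ ι` is a smooth embedding (landed
`stub_conformalEmbedding`), and Cor. 1.5 (b) concludes.  No separation hypothesis is needed. [folklore] -/
theorem simplyConnectedRecognition_of_cor15b_of_certificates
    (hb : ChodoshMantoulidisSchulze2025_cor15b_four)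
    (hmid : ∀ T : ℝ, 1 / 100 ≤ T → T ≤ 10 →
      ∃ (n : ℕ) (σ τ w : Fin n → ℝ) (c : ℝ), (∀ j, 0 < τ j) ∧ (∀ j, 0 ≤ w j) ∧ 0 ≤ c ∧ (∑ j, w j) + c ≤ 147 / 100 ∧
        ∀ u s : ℝ, -1 ≤ s → s ≤ 1 →
          (8 * Real.pi ^ 2 / 3) * ((4 * Real.pi * T) ^ 2)⁻¹ * Real.exp (4 * u) *
              Real.exp (-(Real.exp (2 * u) - 2 * Real.exp u * s + 1) / (4 * T)) ≤
            (∑ j, w j * (SphericalCylinderEntropy.zonal (τ j) s * Real.exp (-(u - σ j) ^ 2 / (4 * τ j)))) + c) :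
    ∃ ε : ℝ, 0 < ε ∧ ∀ (P : Type) [TopologicalSpace P] [T2Space P] [SecondCountableTopology P]
      [ChartedSpace E4 P] [IsManifold (𝓡 4) ∞ P] [CompactSpace P] [ConnectedSpace P],
      SimplyConnectedSpace P → ∀ ι : P → E6, Manifold.IsSmoothEmbedding (𝓡 4) (𝓡 6) ∞ ι →
      (∀ x, ∑ i : Fin 5, ι x (Fin.castSucc i) ^ 2 = 1) →
      cylEntropy (Set.range ι) < ENNReal.ofReal (1 + ε) →
      Nonempty (P ≃ₘ⟮𝓡 4, 𝓡 4⟯ Metric.sphere (0 : E5) 1) := by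
  have he0 : 0 < Real.exp 1 := Real.exp_pos 1
  have he2 : Real.exp 1 < 2.7182818286 := Real.exp_one_lt_d9
  -- all-scales domination with constant `147/100`
  have hdom := stub_dominationBookkeeping (147 / 100) reductionCertificates_sphereEntropy_le
    (reductionCertificates_certAll hmid)
  -- the explicit `ε`
  set ε : ℝ := 4 / (147 / 100 * Real.exp 1) - 1 with hε
  have hεpos : 0 < ε := by
    rw [hε, sub_pos, lt_div_iff₀ (by positivity)]
    nlinarith
  have hCε : (147 / 100 : ℝ) * (1 + ε) = 4 / Real.exp 1 := by
    rw [hε]; field_simp; ring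
  refine ⟨ε, hεpos, ?_⟩
  intro P _ _ _ _ _ _ _ hsc ι hι hN hent
  -- the cross-section `A = range ι ⊆ N`: measurable, of bounded height
  have hAN : Set.range ι ⊆ {z : E6 | ∑ i : Fin 5, z (Fin.castSucc i) ^ 2 = 1} := by
    rintro _ ⟨x, rfl⟩
    exact hN x
  have hcpt : IsCompact (Set.range ι) := isCompact_range hι.isEmbedding.continuous
  have hAm : MeasurableSet (Set.range ι) := hcpt.isClosed.measurableSet
  have hAb : ∃ B : ℝ, ∀ z ∈ Set.range ι, |z 5| ≤ B := by
    obtain ⟨B, hB⟩ := hcpt.exists_bound_of_continuousOn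
      ((EuclideanSpace.proj (5 : Fin 6)).continuous.continuousOn)
    exact ⟨B, fun z hz => by simpa [Real.norm_eq_abs] using hB z hz⟩
  -- the Euclidean entropy of `Φ(range ι)` is at most `4/e = λ(S² × ℝ²)`
  have hbound : gaussianEntropy 4 ((fun z : E6 =>
      (WithLp.toLp 2 (fun i : Fin 5 => Real.exp (z 5) * z (Fin.castSucc i)) : E5)) '' Set.range ι) ≤
      gaussianEntropy 4 (shrinkingCylinder 4 2) := by
    calc gaussianEntropy 4 ((fun z : E6 =>
      (WithLp.toLp 2 (fun i : Fin 5 => Real.exp (z 5) * z (Fin.castSucc i)) : E5)) '' Set.range ι)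
        ≤ ENNReal.ofReal (147 / 100) * cylEntropy (Set.range ι) := hdom _ hAN hAm hAb
      _ ≤ ENNReal.ofReal (147 / 100) * ENNReal.ofReal (1 + ε) := by gcongr
      _ = ENNReal.ofReal (4 / Real.exp 1) := by
          rw [← ENNReal.ofReal_mul (by norm_num), hCε]
      _ = gaussianEntropy 4 (shrinkingCylinder 4 2) := gaussianEntropy_shrinkingCylinder_four_two.symm
  -- recognition: `Φ ∘ ι` is a smooth embedding and Cor. 1.5 (b) for the simply connected `P`
  have hemb : Manifold.IsSmoothEmbedding (𝓡 4) (𝓡 5) ∞ ((fun z : E6 =>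
      (WithLp.toLp 2 (fun i : Fin 5 => Real.exp (z 5) * z (Fin.castSucc i)) : E5)) ∘ ι) :=
    stub_conformalEmbedding P ι hι hN
  refine hb P hsc _ hemb ?_
  rwa [Set.range_comp]

/-- Recognition of nearly calibrated simply connected cross-sections from Cor. 1.5 (b) and the mid-scale certificates (registered
stub `stub_certMid`, = the tree's computational `certMid_all`). [folklore] -/
theorem simplyConnectedRecognition_of_cor15b (hb : ChodoshMantoulidisSchulze2025_cor15b_four) :
    ∃ ε : ℝ, 0 < ε ∧ ∀ (P : Type) [TopologicalSpace P] [T2Space P] [SecondCountableTopology P]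
      [ChartedSpace E4 P] [IsManifold (𝓡 4) ∞ P] [CompactSpace P] [ConnectedSpace P],
      SimplyConnectedSpace P → ∀ ι : P → E6, Manifold.IsSmoothEmbedding (𝓡 4) (𝓡 6) ∞ ι →
      (∀ x, ∑ i : Fin 5, ι x (Fin.castSucc i) ^ 2 = 1) →
      cylEntropy (Set.range ι) < ENNReal.ofReal (1 + ε) →
      Nonempty (P ≃ₘ⟮𝓡 4, 𝓡 4⟯ Metric.sphere (0 : E5) 1) :=
  simplyConnectedRecognition_of_cor15b_of_certificates hb stub_certMid

/-- **Immortal-leaf recognition from the immortal half and Cor. 1.5 (b)**: the landed relaxation glue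
(`stub_relaxationOfAreaToFloor stub_hamiltonMonotonicity`: area to the floor ⇒ `λ_cyl(F s) < 1 + ε` for all late `s`) applied with
the `ε₀` of `simplyConnectedRecognition_of_cor15b`, then that recognition at one late slice. [folklore] -/
theorem immortalLeafRecognition_of (hAF : AreaToFloor) (hb : ChodoshMantoulidisSchulze2025_cor15b_four) :
    ImmortalLeafRecognition := by
  obtain ⟨ε, hε, hrec⟩ := simplyConnectedRecognition_of_cor15b hb
  intro P _ _ _ _ _ _ _ hsc F ν T hflow hsep hent
  obtain ⟨t₀, hTt₀, hsmall⟩ := stub_relaxationOfAreaToFloor stub_hamiltonMonotonicity hAF P F ν T hflow hsep hent ε hε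
  exact hrec P hsc (F t₀) (hflow.isSmoothEmbedding t₀ hTt₀) (hflow.mem_cyl t₀ hTt₀) (hsmall t₀ le_rfl)

/-- **The topology of the surgery tree**: a SIMPLY CONNECTED slice resolved by a mean curvature flow with neck surgery in `N` is
neck-surgery resolvable in Hamilton's sense (`Literature.Geometry.Riemannian.IsNeckSurgeryResolvable`), provided immortal leaves are
recognised — Daniels-Holgate's backward induction, as in the tree's Euclidean `MCFNeckSurgeryResolvable.isNeckSurgeryResolvable`: a
discarded component is a model piece; flows and reparametrisations do not change the manifold; a cut along a separating neck is the
`surgery` constructor, both canonically capped sides being simply connected (`NeckCapData.isConnectedSum_capped`,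
`IsConnectedSum.simplyConnectedSpace_left/right`); a simply connected slice has no non-separating neck
(`not_isPreconnected_compl_image_neck`); an immortal leaf is `≅ S⁴` by `hrec`, hence a model piece.
[cite: DanielsHolgate2022, Lemma 6.2 and proof of Thm. 6.4] [cite: Hamilton1997, §1.1 pp. 3–4] -/
theorem CylNeckSurgeryResolvable.isNeckSurgeryResolvable (hrec : ImmortalLeafRecognition) {M : Type} [TopologicalSpace M]
    [ChartedSpace E4 M] {κ : M → E6} (h : CylNeckSurgeryResolvable M κ) (hsc : SimplyConnectedSpace M) :
    IsNeckSurgeryResolvable M := by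
  induction h with
  | discard hM κ => exact .piece hM.isHamiltonPICPiece
  | flow hT hF h ih => exact ih hsc
  | of_diffeomorph h e ih =>
    exact (ih ((e.toHomeomorph.toHomotopyEquiv.simplyConnectedSpace_iff).2 hsc)).of_diffeomorph e
  | cut κ D₁ D₂ hdisj hcover κ₁ κ₂ h₁ h₂ ih₁ ih₂ =>
    haveI := hsc
    have hcs := D₁.isConnectedSum_capped D₂ (fun _ _ => rfl) hdisj hcover
    have h2 : 1 < Module.finrank ℝ E4 := by
      rw [finrank_euclideanSpace_fin]
      norm_num
    exact .surgery D₁ D₂ hdisj hcover (ih₁ (hcs.simplyConnectedSpace_left h2))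
      (ih₂ (hcs.simplyConnectedSpace_right h2))
  | cutNonseparating κ hψ hψo hns κ' h ih =>
    rename_i M _ _ _ _ ψ
    haveI := hsc
    haveI : LocallyPathConnectedSpace M := ChartedSpace.locallyPathConnectedSpace E4 M
    haveI : Nonempty (Metric.sphere (0 : EuclideanSpace ℝ (Fin 4)) 1) := ⟨unitSpherePoint 3⟩
    exact absurd hns (not_isPreconnected_compl_image_neck ⟨hψ.isEmbedding, hψo⟩)
  | immortal hF hsep hthin =>
    rename_i P _ _ _ _ _ _ _ F ν T
    exact .of_nonempty_diffeomorph_sphere (hrec P hsc F ν T hF hsep hthin)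

/-- **A simply connected closed `4`-manifold, a slice of which is resolved by a mean curvature flow with neck surgery in `N`, is
diffeomorphic to `S⁴`** (given immortal-leaf recognition): it is neck-surgery resolvable, hence a connected sum of copies of `S⁴`
(`IsNeckSurgeryResolvable.nonempty_diffeomorph_sphere`, Kervaire–Milnor `S⁴ # S⁴ ≅ S⁴`). [cite: DanielsHolgate2022, proof of Thm. 6.4]
[cite: KervaireMilnor1963, §2, Lemma 2.1] -/
theorem CylNeckSurgeryResolvable.nonempty_diffeomorph_sphere (hrec : ImmortalLeafRecognition) {M : Type}
    [TopologicalSpace M] [ChartedSpace E4 M] [IsManifold (𝓡 4) ∞ M] {κ : M → E6} (h : CylNeckSurgeryResolvable M κ)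
    (hsc : SimplyConnectedSpace M) : Nonempty (M ≃ₘ⟮𝓡 4, 𝓡 4⟯ S4) :=
  (h.isNeckSurgeryResolvable hrec hsc).nonempty_diffeomorph_sphere hsc

/-- **The crux from the surgery path (kernel-checked; no sorry in this proof)**: mean curvature flow with neck surgery in `N`
(`CylinderSurgeryFlow`) resolves a slice of the homotopy sphere `M`, which is simply connected (tree:
`simplyConnectedSpace_of_homotopyEquiv_sphere_four`), so by the topology of the surgery tree and the recognition of immortal leaves
(the immortal half `AreaToFloor` + Cor. 1.5 (b)) `M ≅ S⁴`. [folklore] -/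
theorem cylinderRungTwo_of_surgery (h₁ : CylinderSurgeryFlow) (h₂ : AreaToFloor)
    (hb : ChodoshMantoulidisSchulze2025_cor15b_four) : CylinderRungTwo := by
  intro M _ _ _ _ _ e ι hι hN hsep hent
  haveI : CompactSpace M :=
    Literature.Topology.FourManifolds.compactSpace_of_homotopyEquiv_sphere_four_holds M e
  haveI : PathConnectedSpace M := by
    haveI := Literature.Topology.FourManifolds.pathConnectedSpace_sphere_four
    exact Literature.Topology.FourManifolds.pathConnectedSpace_of_homotopyEquiv e
  have hsc : SimplyConnectedSpace M :=
    Literature.Topology.FourManifolds.simplyConnectedSpace_of_homotopyEquiv_sphere_four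
      Literature.Topology.FourManifolds.simplyConnectedSpace_sphere_four_holds M e
  obtain ⟨κ, hres⟩ := h₁ M e ι hι hN hsep hent
  exact hres.nonempty_diffeomorph_sphere (immortalLeafRecognition_of h₂ hb) hsc

end SurgeryPath

/-- STUB 1 · THE FINITE-TIME HALF (r1 registered stub, promoted; since r17 a DERIVED theorem): an immortal smooth thin separating flow
of `M` itself in the slab of `ι` — from the surgery path (`stub_cylinderSurgeryFlow`, `stub_areaToFloor`, `stub_cor15bFour` give the
crux by `cylinderRungTwo_of_surgery`, and the crux gives the finite-time half by the landed static-slice transport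
`helper_finiteTimeHalfOfCylinderRungTwo`, p126705).  [crux-equivalent; promoted to the planners by lead A]
[cite: ChodoshMantoulidisSchulze2025, Cor. 1.5 (b)] -/
theorem stub_finiteTimeHalf :
    ∀ (M : Type) [TopologicalSpace M] [T2Space M] [SecondCountableTopology M]
      [ChartedSpace (EuclideanSpace ℝ (Fin 4)) M] [IsManifold (𝓡 4) ∞ M],
      M ≃ₕ Metric.sphere (0 : EuclideanSpace ℝ (Fin 5)) 1 →
      ∀ ι : M → EuclideanSpace ℝ (Fin 6), Manifold.IsSmoothEmbedding (𝓡 4) (𝓡 6) ∞ ι →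
      (∀ x, ∑ i : Fin 5, ι x (Fin.castSucc i) ^ 2 = 1) → SeparatesEnds (Set.range ι) →
      cylEntropy (Set.range ι) < ENNReal.ofReal (4 / Real.exp 1) →
      ∃ (F : ℝ → M → EuclideanSpace ℝ (Fin 6)) (ν : ℝ → M → EuclideanSpace ℝ (Fin 6)) (T : ℝ),
        IsCylinderMCF M F ν T ∧
        (∀ t, T ≤ t → SeparatesEnds (Set.range (F t))) ∧
        (∀ t, T ≤ t → cylEntropy (Set.range (F t)) < ENNReal.ofReal (4 / Real.exp 1)) ∧
        (∀ t, T ≤ t → ∀ x, ∃ y y' : M, ι y 5 - 1 ≤ F t x 5 ∧ F t x 5 ≤ ι y' 5 + 1) :=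
  helper_finiteTimeHalfOfCylinderRungTwo (cylinderRungTwo_of_surgery stub_cylinderSurgeryFlow stub_areaToFloor stub_cor15bFour)

/-! ## Composition (sorry-free) -/

/-- `4/e ≤ 2` in `ℝ≥0∞` (`2 ≤ e`): the entropy bound handed over by STUB 1 is below the single-sheet
threshold of STUB 3. [folklore] -/
theorem ofReal_four_div_exp_le_two : ENNReal.ofReal (4 / Real.exp 1) ≤ 2 := by
  have h : 4 / Real.exp 1 ≤ 2 := by
    rw [div_le_iff₀ (Real.exp_pos 1)]
    linarith [Real.add_one_le_exp (1 : ℝ)]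
  calc ENNReal.ofReal (4 / Real.exp 1) ≤ ENNReal.ofReal 2 := ENNReal.ofReal_le_ofReal h
    _ = 2 := by simp

/-- **Main composition (kernel-checked; no sorry in this proof).** The crux — written readably with
the tree's `cylEntropy` and this file's `SeparatesEnds`, which is the route decl `CylinderRungTwo` up to
unfolding definitions (see `CylinderRungTwo_of`) — from the five stub statements: STUB 1 gives an
immortal smooth flow of cross-section embeddings of `M` with `λ_cyl < 4/e ≤ 2`; STUB 3 relaxes it below
the universal `1 + ε` of STUB 4 (obtained from STUB 2) from some `t₀` on; STUB 4 at time `t₀ + 1` makes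
`F (t₀+1)` graphical; STUB 5 concludes. Instances `CompactSpace M`, `ConnectedSpace M` from `M ≃ₕ S⁴`
are PROVED tree theorems. -/
theorem cylinderRungTwo_of_parts (h₁ : FiniteTimeHalf) (h₂ : FluxIdentity) (h₃ : Relaxation)
    (h₄ : FluxIdentity → EpsilonGraphical) (h₅ : GraphicalIsSphere) :
    ∀ (M : Type) [TopologicalSpace M] [T2Space M] [SecondCountableTopology M]
      [ChartedSpace E4 M] [IsManifold (𝓡 4) ∞ M],
      M ≃ₕ Metric.sphere (0 : E5) 1 → ∀ ι : M → E6, Manifold.IsSmoothEmbedding (𝓡 4) (𝓡 6) ∞ ι →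
      (∀ x, ∑ i : Fin 5, ι x (Fin.castSucc i) ^ 2 = 1) → SeparatesEnds (Set.range ι) →
      cylEntropy (Set.range ι) < ENNReal.ofReal (4 / Real.exp 1) →
      Nonempty (M ≃ₘ⟮𝓡 4, 𝓡 4⟯ Metric.sphere (0 : E5) 1) := by
  intro M _ _ _ _ _ e ι hι hN hsep hent
  -- instances from `M ≃ₕ S⁴` (PROVED in the tree)
  haveI : CompactSpace M :=
    Literature.Topology.FourManifolds.compactSpace_of_homotopyEquiv_sphere_four_holds M e
  haveI : PathConnectedSpace M := by
    haveI := Literature.Topology.FourManifolds.pathConnectedSpace_sphere_four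
    exact Literature.Topology.FourManifolds.pathConnectedSpace_of_homotopyEquiv e
  -- STUB 4 (from STUB 2): the universal ε of the graphical regime
  obtain ⟨ε, hε, hgraph⟩ := h₄ h₂
  -- STUB 1: the finite-time half — an immortal smooth flow of cross-section embeddings of `M`
  obtain ⟨F, ν, T, hflow, hsepF, hentF, -⟩ := h₁ M e ι hι hN hsep hent
  have h2 : ∀ t, T ≤ t → cylEntropy (Set.range (F t)) < 2 := fun t ht =>
    lt_of_lt_of_le (hentF t ht) ofReal_four_div_exp_le_two
  -- STUB 3: relaxation below `1 + ε` from some time `t₀ ≥ T` on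
  obtain ⟨t₀, hTt₀, hsmall⟩ := h₃ M F ν T hflow hsepF h2 ε hε
  -- STUB 4 at time `t₀ + 1`: after one unit of flow in the `(1+ε)`-regime the cross-section is graphical
  have hg : IsGraphical M (F (t₀ + 1)) :=
    hgraph M F ν T hflow (t₀ + 1) (by linarith)
      (fun s hs => hsepF s (by linarith [hs.1]))
      (fun s hs => hsmall s (by linarith [hs.1]))
  -- STUB 5: a graphical cross-section is a standard sphere
  exact h₅ M (F (t₀ + 1)) (hflow.isSmoothEmbedding _ (by linarith)) (hflow.mem_cyl _ (by linarith)) hg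

/-- **The skeleton concludes the crux BY NAME** (lead reshape r15: THE SURGERY PATH).  `CylinderEntropy.CylinderRungTwo`
(stmt-SmoothPoincare4-7631) from the three registered stubs `stub_cylinderSurgeryFlow` (mean curvature flow with neck surgery in
`N`, the finite-time half), `stub_areaToFloor` (the immortal half = route crux ImmortalAreaToFloor, stmt-17197) and
`stub_cor15bFour` (Chodosh–Mantoulidis–Schulze 2025 Cor. 1.5 (b), `n = 4`, published named fact), through the LANDED reduction
`helper_cylinderRungTwoOfSurgery` (p137048: topology of the surgery tree + recognition of immortal leaves; `stub_certMid` is the landed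
computational certificate stub, kept sorried here for standard axioms).  The route decl unfolds to the readable statement by `rfl`
(`cylEntropy`, `SeparatesEnds`, `cylN` are the typed expressions verbatim). -/
theorem CylinderRungTwo_of : CylinderRungTwo :=
  helper_cylinderRungTwoOfSurgery stub_cylinderSurgeryFlow stub_areaToFloor stub_cor15bFour stub_certMid

/-- The same through the readable in-file glue of r15 (`cylinderRungTwo_of_surgery`; cross-check that the LANDED reduction
`helper_cylinderRungTwoOfSurgery` (p137048, `Theorems/CylinderEntropyCylinderRungTwoSurgeryTopology.lean`) and the in-file composition
agree on the registered stubs). [folklore] -/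
theorem CylinderRungTwo_of_surgery' : CylinderRungTwo :=
  cylinderRungTwo_of_surgery stub_cylinderSurgeryFlow stub_areaToFloor stub_cor15bFour

/-- Path A as a HYPOTHESIS-STYLE theorem (r12 Reduction, kept; no sorry beyond `stub_finiteTimeHalf`): the crux from the finite-time
half and the two published named facts of Allard and White (`helper_cylinderRungTwoOfNamedFacts`, p127456). [folklore] -/
theorem CylinderRungTwo_of_namedFacts
    (hA : Literature.Geometry.GeometricMeasureTheory.Allard1972_integralDensityOfLimits_cylinderCrossSections)
    (hW : Literature.Geometry.Riemannian.White2005_localRegularity_cylinderFlowSheet) : CylinderRungTwo :=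
  helper_cylinderRungTwoOfNamedFacts stub_finiteTimeHalf hA hW

/-- The same through the readable in-file composition of r1 (cross-check that the registered stubs still compose along path A,
hypothesis-style in White's fact). [folklore] -/
theorem CylinderRungTwo_of' (hW : Literature.Geometry.Riemannian.White2005_localRegularity_cylinderFlowSheet) : CylinderRungTwo :=
  cylinderRungTwo_of_parts stub_finiteTimeHalf stub_fluxIdentity
    (stub_relaxationOfAreaToFloor stub_hamiltonMonotonicity stub_areaToFloor)
    (epsilonGraphical_of (stub_tiltGap (epsilonRegularity_of_white hW)) stub_oneSheet) stub_graphicalIsSphere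

/-- **`CylinderRungTwo ↔ FiniteTimeHalf` modulo the two published named facts of Allard and White** (lead c3, path A;
hypothesis-style since r15): `→` is the LANDED `helper_finiteTimeHalfOfCylinderRungTwo` (p126705, unconditional), `←` the LANDED
path-A Reduction. -/
theorem cylinderRungTwo_iff_finiteTimeHalf
    (hA : Literature.Geometry.GeometricMeasureTheory.Allard1972_integralDensityOfLimits_cylinderCrossSections)
    (hW : Literature.Geometry.Riemannian.White2005_localRegularity_cylinderFlowSheet) : CylinderRungTwo ↔ FiniteTimeHalf :=
  ⟨fun h => helper_finiteTimeHalfOfCylinderRungTwo h, fun h => helper_cylinderRungTwoOfNamedFacts h hA hW⟩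

/-- **`stub_finiteTimeHalf` is a COROLLARY of the surgery path** (r15): the crux implies it unconditionally (landed
`helper_finiteTimeHalfOfCylinderRungTwo`, p126705: static slice transport), so
`stub_cylinderSurgeryFlow ∧ stub_areaToFloor ∧ stub_cor15bFour ⇒ FiniteTimeHalf`. [folklore] -/
theorem finiteTimeHalf_of_surgery (h₁ : CylinderSurgeryFlow) (h₂ : AreaToFloor)
    (hb : ChodoshMantoulidisSchulze2025_cor15b_four) : FiniteTimeHalf :=
  helper_finiteTimeHalfOfCylinderRungTwo (cylinderRungTwo_of_surgery h₁ h₂ hb)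

/-! ## Second path (lead C reshape r8): through the route's rank-3 crux `SliceIsolation` BY NAME

The landed flow interface of support item stmt-SmoothPoincare4-14765
(`Theorems/CylinderEntropyRungTwoOfSliceIsolationReduction.lean`, `rungTwoOfSliceIsolation_of_flow`) consumes of a flow
predicate only that its time slices are smooth embeddings into `N`; with `Flow := IsCylinderMCF`, STUB 1 (minus its slab
clause) and RELAXATION (= the landed `stub_relaxationOfAreaToFloor` over the landed `stub_hamiltonMonotonicity` and
`stub_areaToFloor`, i.e. modulo `stub_areaQuantization` only) it yields item 14765, `SliceIsolation → CylinderRungTwo`.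
So the crux follows from {`stub_finiteTimeHalf`, `stub_areaQuantization`} and the rank-3 crux `SliceIsolation`
(stmt-SmoothPoincare4-7632, whose own line `conformal-kernel-domination` is closed modulo the published CMS fact, a static
flatness stub and kernel certificates — no parabolic regularity), WITHOUT `stub_epsilonRegularity` (White). -/

open Summit.SmoothPoincare4.SmoothPoincare4.Theses.CylinderEntropy (SliceIsolation RungTwoOfSliceIsolation) in
/-- **Item stmt-SmoothPoincare4-14765 `RungTwoOfSliceIsolation` modulo exactly {`stub_finiteTimeHalf`,
`stub_areaToFloor`}** (lead C reshape r8; kernel-checked): `rungTwoOfSliceIsolation_of_flow` with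
`Flow := IsCylinderMCF`, `h₁ :=` STUB 1 without its slab clause, `h₃ :=` the landed relaxation chain.
(`SeparatesEnds`/`cylN` unfold to the item's typed `JoinedIn` clause by `rfl`.) [folklore] -/
theorem rungTwoOfSliceIsolation_of_stubs : RungTwoOfSliceIsolation :=
  Summit.SmoothPoincare4.SmoothPoincare4.Theorems.CylinderEntropyRungTwoOfSliceIsolation.rungTwoOfSliceIsolation_of_flow
    (fun M _ _ _ F ν T => IsCylinderMCF M F ν T)
    (fun M _ _ _ F ν T (hflow : IsCylinderMCF M F ν T) t ht => hflow.isSmoothEmbedding t ht)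
    (fun M _ _ _ F ν T (hflow : IsCylinderMCF M F ν T) t ht x => hflow.mem_cyl t ht x)
    (fun M _ _ _ _ _ e ι hι hN hsep hent => by
      obtain ⟨F, ν, T, hflow, hsepF, hentF, -⟩ := stub_finiteTimeHalf M e ι hι hN hsep hent
      exact ⟨F, ν, T, hflow, hsepF, hentF⟩)
    (fun M _ _ _ _ _ _ _ F ν T hflow hsep hent =>
      stub_relaxationOfAreaToFloor stub_hamiltonMonotonicity stub_areaToFloor M F ν T hflow hsep hent)

open Summit.SmoothPoincare4.SmoothPoincare4.Theses.CylinderEntropy (SliceIsolation) in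
/-- **Path B: the crux from `SliceIsolation` (stmt-SmoothPoincare4-7632, by name) and the stubs
{`stub_finiteTimeHalf`, `stub_areaToFloor`}** — no White ε-regularity, no flux identity, no graph argument, no Allard.
[folklore] -/
theorem CylinderRungTwo_of_sliceIsolation (hI : SliceIsolation) : CylinderRungTwo :=
  rungTwoOfSliceIsolation_of_stubs hI

/-- **Path B closed by `stub_cor15bFour`** (r15): `SliceIsolation` is the landed `helper_sliceIsolationOfCor15b` (p132345) applied
to the named fact, so the crux also follows from {`stub_finiteTimeHalf`, `stub_areaToFloor`, `stub_cor15bFour`} — the second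
sorry-free composition of this skeleton, through the OLD cut of the finite-time half. [folklore] -/
theorem CylinderRungTwo_of_finiteTimeHalf : CylinderRungTwo :=
  CylinderRungTwo_of_sliceIsolation
    (Summit.SmoothPoincare4.SmoothPoincare4.Theorems.CylinderEntropySliceIsolation.sliceIsolation_of_cor15b_of_certificates
      stub_cor15bFour stub_certMid)

open Summit.SmoothPoincare4.SmoothPoincare4.Theses.CylinderEntropy (SliceIsolation) in
/-- **`CylinderRungTwo ↔ FiniteTimeHalf` modulo the immortal half and Cor. 1.5 (b)** (r15 form of lead c3's equivalence; no
White, no Allard): `→` is the landed `helper_finiteTimeHalfOfCylinderRungTwo` (unconditional), `←` is path B through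
`AreaToFloor` and `SliceIsolation` from Cor. 1.5 (b). -/
theorem cylinderRungTwo_iff_finiteTimeHalf' (h₂ : AreaToFloor) (hb : ChodoshMantoulidisSchulze2025_cor15b_four) :
    CylinderRungTwo ↔ FiniteTimeHalf :=
  ⟨fun h => helper_finiteTimeHalfOfCylinderRungTwo h, fun h₁ =>
    Summit.SmoothPoincare4.SmoothPoincare4.Theorems.CylinderEntropyRungTwoOfSliceIsolation.rungTwoOfSliceIsolation_of_flow
      (fun M _ _ _ F ν T => IsCylinderMCF M F ν T)
      (fun M _ _ _ F ν T (hflow : IsCylinderMCF M F ν T) t ht => hflow.isSmoothEmbedding t ht)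
      (fun M _ _ _ F ν T (hflow : IsCylinderMCF M F ν T) t ht x => hflow.mem_cyl t ht x)
      (fun M _ _ _ _ _ e ι hι hN hsep hent => by
        obtain ⟨F, ν, T, hflow, hsepF, hentF, -⟩ := h₁ M e ι hι hN hsep hent
        exact ⟨F, ν, T, hflow, hsepF, hentF⟩)
      (fun M _ _ _ _ _ _ _ F ν T hflow hsep hent =>
        stub_relaxationOfAreaToFloor stub_hamiltonMonotonicity h₂ M F ν T hflow hsep hent)
      (Summit.SmoothPoincare4.SmoothPoincare4.Theorems.CylinderEntropySliceIsolation.sliceIsolation_of_cor15b_of_certificates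
        hb stub_certMid)⟩

end Summit.SmoothPoincare4.SmoothPoincare4.Cruxes.CylinderRungTwo.KillingFlux

end
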